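/-
Copyright: statement-level skeleton of a published paper (lit-balaban cell, Phase-2 proof seat p39 gen 30). No proof claims
beyond what the kernel checks below.
-/
import Literature.MathematicalPhysics.QuantumFieldTheory.Balaban1983to89.B3Eq123RenormalizationConditions
import Literature.MathematicalPhysics.QuantumFieldTheory.Balaban1983to89.B3Eq123IndexTwoOne

/-!
# Bałaban, *(Higgs)₂,₃ quantum fields in a finite volume. III*, CMP 88 (1983) [Balaban1983Higgs3], p. 417: THE VACUUM-ENERGY
# COUNTERTERM (1.24) AT THE INDEX `(α,β) = (2,1)` — the `e²λ` term of `E₁` for the action (1.20) WITH print's counterterm series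
# `δm² = δm²_{(2,0)}e² + δm²_{(0,1)}λ + δm²_{(2,1)}e²λ + δm²_{(4,0)}e⁴` INSERTED, read in the order of the body of record
# (`∂²/∂e²` at `e = 0` OF the right derivative `(∂/∂λ)⁺` at `λ = 0⁺`), DERIVED from the measure — one-sided dominated
# differentiation under `∫dA dφ` at every charge, quotient curves in the charge — and EVALUATED by Wick's theorem at print's
# `δm²_{(0,1)}`: of all vacuum graphs of order `e²λ` only the counterterm bubble `−δm²_{(2,1)}·N·Σ_xε^dC^ε_0(x,x)` survives

statement-level skeleton of published theorems with citation tags; proofs where landed; nothing here is a claim about the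
Yang–Mills mass gap.

[cite: Balaban1983Higgs3, (1.24) p.417 (PDF 7) and the first paragraph of p.418 (PDF 8); (1.19)–(1.22) p.416 (PDF 6); (1.23) and
the paragraph before it p.417; (1.6)–(1.10) p.413 (PDF 3)] [cite: GlimmJaffeQP1987, §8.3–8.5 (Gaussian integrals, integration by
parts / Wick's theorem, Feynman graphs, perturbation series), Cor. 8.3.2, (9.1.5)].
Unit `lit-balaban-p39-g30` (Phase-2 proof seat p39, gen 30), free-target protocol G.5-34(d), ZERO head weight: OPTIONAL LOCATED
MEMBER of row **B3.Eq1.24** of `HOME/lit-balaban-r15/ROWS-B3.md` (owner r15; head `proved`, decl of record r01's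
`B1Sect1Statements.ModelData.e1R` / r15's `B3Sect1TwoPoint.E1of124R`, neither restated here); TAKING `HOME/STATUS.md`
2026-08-24T14:37:29Z, owner r15 cc'd.  BRICK 16 of this seat's series on (1.19)–(1.24) (BRICK 15 `B3Eq124IndexZeroThree` = the
index `(0,3)`, landed p381120 the same session).  IMPORTED: BRICK 7 `B3Eq122ChargeWick` (this seat, gen 24: the joint weight
`J_e(M)(A,φ) = W_A(A)·e^{−½⟨φ,(−Δ^η_{eA}+M)φ⟩}` of (1.19)–(1.20) in the Feynman gauge on `JCfg = (A,φ)`, its charge insertions `D₁,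
D₂`, `integrable_J_mul`, `integral_J_pos`, `integral_D1_J_zero`, `integral_D2_J_zero`, `ZA_pos`, `integral_prod_WA_W0`; through it
BRICK 1 `B3Eq122FirstOrderWick` (`ExpGrowth`, `expGrowth_V`, `integral_sumWick4`), `B3WickVertexCalculus` (`wick4`,
`integral_wick4_mul`, `integral_wick4_mul_of_deg2`, `expGrowth_wick4`, `hx`, `DerivAlong`), `B3BilinearWick`, `B3WTCovariance`
(`G_diag`, `C0`, `moment2_op`), `B3WT226Traces.Z_pos`); and — since v1.1, their farm oleans being built (importer probes rc 0,
2026-08-24T17:3xZ) — BRICK 14 `B3Eq123IndexTwoOne` (gen 29: the two-point index `(2,1)` of (1.23); its §2 quotient curves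
`hasDerivAt_quot_curve_of_ball`, `hasDerivAt_deriv_quot_curve_zero_of_ball`, §3 `integral_J_zero_mul`, `expGrowth_X`,
`iteratedDeriv_two_quot_curve_eq_moments`, §4/§6/§8 `neg_le_U`, `expGrowth_U`, `U_eq_sumWick4_of_print`, `integral_wick4_Y`,
`integral_W_Y` are used BY NAME) and BRICK 10 `B3Eq123RenormalizationConditions` (`J_mass_add`, `expGrowth_massForm`).  v1.0 (written
while those oleans were unbuilt, probes rc 75 2026-08-24T14:1xZ) carried ≈ 990 lines of PRIVATE statement-identical copies of BRICK
14 §1–§4 here; v1.1 deletes them (nothing of record was or is redeclared; every public declaration below is unchanged).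

PDF held: `paper:balaban1983-higgs-2-3-quantum-fields-finite-volume` (journal page = PDF page + 410); (1.24) and the prose around
it were read for BRICKS 12/13/15 on the ×2 renders `run/shared/lean/pub/pub-balaban/b2b-balaban-ref1/pages/1983-cmp88-higgs23-III/
1983-cmp88-higgs23-III-p007-x2.png`, `…-p008-x2.png` (quotations below as verified there by ref-1 g107/g108 and ref-4 g90/g91), and
the paragraph before (1.23) on p. 417 was RE-READ for this file on the OCR layer (`~/.lit/texts/paper-balaban1983-…/p0007.txt`,
2026-08-24T14:5xZ).

THE PRINTED TEXT (verbatim).  P. 417: *"This equation can be solved recursively if δm² and Σ^ε are expanded into power series in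
e, λ. In our case δm² will be defined by the terms of order ≦ 4. More exactly we write δm² = Σ_{2≦α+2β≦4}e^αλ^βδm²_{(α,β)} and we
insert this into Σ^ε."*; *"Now it is easy to define the vacuum energy counterterm E₁. It is defined by the following perturbation
expansion: E₁ = Σ_{1≤α+β≤n̄}(1/(α!β!))e^αλ^β(∂^{α+β}/∂e^α∂λ^β log∫dA∫dφ e^{−S^ε(A,φ)})∣_{e=λ=0} (1.24)"*; p. 418: *"with n̄ > 12.
In S^ε, defined in (I.1.11), we of course have dropped the term E. Terms of this expansion are described by connected graphs
without external legs (vacuum graphs). To renormalize the theory it is sufficient to take the terms in the expansion (1.24)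
restricted by the condition 2 ≦ α+2β ≦ 6; the other terms are convergent as ε → 0."*  ((I.1.11) = part I's (1.11) = (1.20) + E:
the mass counterterm `½δm²∣φ∣²` IS in `S^ε`, with `δm² = Σ_{2≦α+2β≦4}e^αλ^βδm²_{(α,β)} = δm²_{(2,0)}e² + δm²_{(0,1)}λ + δm²_{(2,1)}e²λ +
δm²_{(4,0)}e⁴ + δm²_{(0,2)}λ²`; the `λ²`-term does not enter a first `λ`-derivative at `0` followed by `e`-derivatives and is
omitted from the family below, as in BRICK 14.)

WHICH TERM OF (1.24) THIS IS.  The body of record of row B3.Eq1.24 is r15's `B3Sect1TwoPoint.E1of124R` = r01's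
`B1Sect1Statements.ModelData.e1R` (typer g30's `B3Eq124OneSidedBridge.E1of124R_eq_pertSum362R_sub` displays its general term):
`(1/(α!β!))·e^α·λ^β·iteratedDeriv α (e′ ↦ iteratedDerivWithin β (λ′ ↦ log Z(e′,λ′)) (Set.Ici 0) 0) 0` — the `λ`-derivatives
ONE-SIDED at `0⁺` and taken FIRST (innermost), at every charge `e′`, the `e`-derivatives two-sided and taken LAST.  This file
computes EXACTLY that iterated derivative at `(α,β) = (2,1)`, `iteratedDeriv 2 (e′ ↦ iteratedDerivWithin 1 (λ′ ↦ log Z^{ct}(e′,λ′))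
(Set.Ici 0) 0) 0`, for the generating function `log Z^{ct}` of the action (1.20) with print's counterterm series inserted, on BRICK
7's concrete torus carrier `Z^{ct}(e,λ) = ∫dA dφ e^{−S^ε_{e, m²+δm²(e,λ)}(A,φ)}e^{−λΣ_yη^d∣φ(y)∣⁴}` (the carriers `e1R`/`E1of124R`
are not bridged to it — an identification of readings, said here, not a theorem; BRICK 14 computed the OTHER order, `∂_λ⁺` of
`∂²_e∣₀`, for the two-point function).  THE COMBINATORIC CONTENT: print draws vacuum graphs without factors (p. 416 *"Here we did
not write, and we will not write in the future, combinatoric factors before the graphs"*); at order `e²λ` the candidate connected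
vacuum graphs are one quartic scalar vertex (1.6) joined to the order-`e²` structure — the `A`-tadpole ② on the seagull vertex
(1.8)₂,₀+(1.10)₂,₀, the vector exchange ④ between two cubic vertices (1.8)₁,₀, the mass bubbles of `δm²_{(2,0)}`, `δm²_{(0,1)}` —
and the bubble of `δm²_{(2,1)}` alone.  §8 proves: at print's `δm²_{(0,1)}` (which Wick-orders the quartic vertex) every graph
containing the quartic vertex VANISHES (② and the mass vertices are bilinear and absorb two of its four legs, the other two would
be a self-line; for ④ each current `⟪φ(b₋),qφ(b₊)⟫` would need both legs at the vertex and `q` is antisymmetric), so the `(2,1)`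
term of `E₁` is `−(1/2)·δm²_{(2,1)}·N·Σ_xε^dC^ε_0(x,x)·e²λ = −(1/2)·δm²_{(2,1)}·N·∣T_ε∣ε^dC^ε_0(0)·e²λ` (`E1_term_21_at_print_d01`),
for ANY numbers `δm²_{(2,0)}, δm²_{(2,1)}, δm²_{(4,0)}`.  WHAT `δm²_{(2,1)}` IS: print's order-`e²λ` mass counterterm, defined
through the order-`e²λ` graphs of (1.23) — the first counterterm ① with its loop line corrected at order `e²` (v1.1, referee-4
D-g95-1: v1.0 said *"the last display of (1.23)"*, but print's last display there is ④ with the `δm₁²` insertion on its internal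
scalar line, whose `e²λ` part is the `δm²_{(0,1)}λ` insertion — the graph cancelling the tadpole on ④ at print's `δm²_{(0,1)}`,
consistent with §8); BRICK 14 `B3Eq123IndexTwoOne` derives its defining equation from the two-point function and names it `K`
(`condition_21_iff`: `δm²_{(2,1)} = K(x)`, `K_eq_firstCounterterm_loopCorrected`) — here it stays the free letter `d21`, the result
being LINEAR in it.  DOES THE `(2,1)` TERM
NEED `δm²_{(4,0)}` (or `δm²_{(2,0)}`)?  NO: both enter `Z^{ct}` (they fix the mass `M_e = m² + δm²_{(2,0)}e² + δm²_{(4,0)}e⁴` of the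
`λ = 0` measure at charge `e`, §6), but the `(2,1)` coefficient is the same number for all their values — `δm²_{(4,0)}e⁴` is
`O(e⁴)` and cannot reach a second `e`-derivative at `0`; `δm²_{(2,0)}` does reach it, through `Y = X − δm²_{(2,0)}Q`, and drops
only at print's `δm²_{(0,1)}` (`Cov₀(Y, V_:) = 0` whatever `Y`'s bilinear part); `δm²_{(0,2)}λ²` is omitted from the family
altogether (a first `λ`-derivative at `0` does not see it), as in BRICK 14.

THE SETTING = BRICK 7's / BRICK 14's: the model torus `T^{(j)}_η` of `B3WT223Instance` (print's `T_ε`, `η = ε`, volume element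
`w = η^d`, `c = η⁻¹`), scalar fields `φ : T → ℝ^N` (`Cfg`), vector fields `A` (`Cfg P j P.d`, bonds `PBond`, `toVec`), the joint
weight `J C η w c M μ2 e (A,φ) = W_A(A)·weight (Ce C e) η w c M (toVec A) φ` (Feynman gauge, vector mass `μ2 > 0`), the free scalar
weight `W₀ = weight C η w c m2 0` at `e = 0` (written out in the statements), its propagator `C₀ = B3WTPropagator.G w c m2`
(print's `C^ε_0`; `C₀(x,x) = C0`), the vector propagator `G w c μ2` (print's `C^ε`), `Q(φ) = Σ_xη^d∣φ(x)∣²` (`massForm`; the vertex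
(1.7) is `½δm²·Q`), `U = Σ_yη^d∣φ(y)∣⁴ + ½δm²_{(0,1)}Q`, the `A`-averaged order-`e²` insertion `X` (print's ②+④ before the scalar
contractions; §3 header) and `Y = X − δm²_{(2,0)}Q` — all observables enter as functions with a defining hypothesis (`hU`, `hX`, …),
so every statement displays its own formula.  Hypotheses throughout: `η^d > 0`, `m² > 0`, `μ2 > 0`; any level `j`, mesh,
dimension `d`, `N`, any antisymmetric charge matrix `q` of norm ≤ 1 (`HiggsLattice.ChargeData`).

WHAT THIS FILE PROVES (theorems only; no definition, no named fact, no `sorry`; standard axioms).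
* §1–§4 (private) BRICK 14's curve lemmas, quotient curves, `e = 0` moments and Wick identities (list above).
* §5 **ONE-SIDED DIFFERENTIATION IN `λ` UNDER `∫dA dφ` AT ANY CHARGE** (new; the joint-measure twin of BRICK 1's
  `hasDerivWithinAt_gaussInt_exp_neg_of_le`): `hasDerivWithinAt_integral_J_exp_neg` (`V ≥ 0`), `…_of_le` (`V ≥ −K`): for `V, F` of
  exponential-linear growth `λ ↦ ∫dA dφ e^{−S^ε_{e,M}}e^{−λV}F` has right-derivative `−∫dA dφ e^{−S^ε_{e,M}}VF` at `0⁺` (dominated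
  convergence of the difference quotients, `∣(e^{−λV} − 1)/λ∣ ≤ ∣V∣`); `hasDerivWithinAt_log_integral_J_exp_neg`,
  `derivWithin_log_integral_J_exp_neg`: **`(∂/∂λ)⁺log∫dA dφ e^{−S^ε_{e,M}}e^{−λV}∣_{λ=0} = −⟨V⟩_{e,M}`**.
* §6 THE INNER DERIVATIVE of the body of record: `Zct_fibre` (at fixed `e` the `λ`-part of the counterterm is a Boltzmann factor:
  `Z^{ct}(e,λ) = ∫dA dφ e^{−S^ε_{e,M_e}}e^{−λ(U + ½δm²_{(2,1)}e²Q)}`, `M_e = m² + δm²_{(2,0)}e² + δm²_{(4,0)}e⁴`); `neg_le_Ue`,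
  `expGrowth_Ue`; **`hasDerivWithinAt_logZct_lam` / `iteratedDerivWithin_one_logZct`: for every `e` with `∣M_e − m²∣ ≤ m²/2`,
  `iteratedDerivWithin 1 (λ ↦ log Z^{ct}(e,λ)) (Set.Ici 0) 0 = −⟨U + ½δm²_{(2,1)}e²Q⟩_e`** (`⟨·⟩_e` = the normalized expectation in
  `∫dA dφ e^{−S^ε_{e,M_e}}`); `iteratedDerivWithin_one_logZct_eventuallyEq`: near `e = 0` this is `−N_U(e)/Z(e) −
  ½δm²_{(2,1)}e²·N_Q(e)/Z(e)` with §2's quotient curves.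
* §7 THE OUTER DERIVATIVE: a [folklore] calculus lemma (`iteratedDeriv 2 (−G − κe²H) 0 = −G″(0) − 2κH(0)` for curves differentiable
  on a ball with derivatives differentiable at `0`) and **`iteratedDeriv_two_index21_raw`: `iteratedDeriv 2 (e ↦ iteratedDerivWithin 1
  (λ ↦ log Z^{ct}(e,λ)) (Set.Ici 0) 0) 0 = −(N_U/Z)″(0) − δm²_{(2,1)}·N_Q(0)/Z(0)`**.
* §8 THE VALUE: **`iteratedDeriv_two_index21_eq_moments` (ANY counterterm letters, cumulant form): `= −Cov₀(Y, U) − δm²_{(2,1)}⟨Q⟩₀`**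
  over the common denominator `(∫W₀)²` (`Y = X − δm²_{(2,0)}Q`: BRICK 7's second charge insertion integrated over `A` — ②, ④ —
  minus its counterterm; the `A`-partition function `Z_A` cancels); `sum_G_diag`; and the headline
  **`iteratedDeriv_two_index21_at_print_d01`: at print's `δm²_{(0,1)} = −4(N+2)C^ε_0(0)`,
  `iteratedDeriv 2 (e ↦ iteratedDerivWithin 1 (λ ↦ log∫dA dφ e^{−S^ε}) (Set.Ici 0) 0) 0 = −δm²_{(2,1)}·N·Σ_xη^dC^ε_0(x,x)`** —
  `Cov₀(Y, Σ_yη^d:∣φ(y)∣⁴:) = 0` (BRICK 14 `integral_W_Y`, BRICK 1 `integral_sumWick4`), `⟨Q⟩₀ = N·Σ_xη^dC^ε_0(x,x)`; with print's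
  prefactor **`E1_term_21_at_print_d01`: the `(2,1)` term of `E₁` is `−(1/2)δm²_{(2,1)}·N·Σ_xη^dC^ε_0(x,x)·e²λ`**; extensive form
  `…_eq_card_mul` (`= −∣T_ε∣·δm²_{(2,1)}·N·η^dC^ε_0(0)`).
* §9 CONSISTENCY AT `(0,1)` on the same carrier: `iteratedDeriv_zero_index01` (`iteratedDeriv 0 (e ↦ iteratedDerivWithin 1 (…) [0,∞)
  0) 0 = −⟨U⟩₀`, the `A`-integral cancels at `e = 0`), `…_at_print_d01` (`= ∣T∣η^dN(N+2)C^ε_0(0)²`, BRICK 12 §10's value).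

HONEST SCOPE.  (a) The ORDER of differentiation is the body of record's (inner `λ` one-sided at `0⁺`, outer `e` at `0`); the other
order and the symmetry of the mixed derivative (joint smoothness, BRICK 11) are neither used nor claimed.  (b) The inner derivative
is computed for every `e` on the ball `∣δm²_{(2,0)}e² + δm²_{(4,0)}e⁴∣ ≤ m²/2` (positivity of the mass along the curve), which is all
the outer `iteratedDeriv 2 · 0` sees (`Filter.EventuallyEq.iteratedDeriv_eq`); outside that ball nothing is said.  (c) The general
form (§8, any `δm²_{(0,1)}`) is the cumulant `−Cov₀(Y,U) − δm²_{(2,1)}⟨Q⟩₀`; its graph expansion for `δm²_{(0,1)} ≠ −4(N+2)C^ε_0(0)`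
(the theta-like graphs «plain quartic vertex self-contracted once × ②/④/bubble») is not evaluated — print inserts ITS `δm²_{(0,1)}`,
at which they all vanish.  (d) `δm²_{(2,0)}, δm²_{(2,1)}, δm²_{(4,0)}` are free real letters: print's values ((1.23); BRICK 10
`condition_20_iff`, BRICK 14 §9) are not inserted — the result does not depend on `δm²_{(2,0)}, δm²_{(4,0)}` and is linear in
`δm²_{(2,1)}`.  (e) Finite torus at fixed `ε = η`: nothing is uniform in `ε`; p. 418's *"convergent as ε → 0"* is not touched.
(f) The identification with `E₁`'s `(2,1)` term reads (1.24)'s `log∫dA∫dφ e^{−S^ε}` as BRICK 7's Feynman-gauge `log Z^{ct}` (as in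
BRICKS 7/10/13/14: r01's `partitionFn` / r15's typed objects are reached only through BRICK 7 §8's bridge), not a theorem about
`e1R`.  (g) v1.0's §1–§4 were private copies (≈ 990 lines); v1.1 replaced them by the imports of BRICKS 14/10 — the public
statements of this file did not change under that swap.  (h) ORDER OF DIFFERENTIATION: the «λ first» datum of this file equals the
«e first» iterated partial `∂_λ⁺[∂²_e log Z^{ct}(·,λ)∣₀](0⁺)` — BRICK 18 `B3Eq123IndexTwoOneOrders` §5
`iteratedDeriv_iteratedDerivWithin_logZct_comm_poly6` (Schwarz within the slab where the running mass stays `≥ m²/2`, every `(α,β)`,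
this seat gen 31); for the two-point function likewise (BRICK 18 §3–§4).

References: [Balaban1983Higgs3] T. Bałaban, *(Higgs)₂,₃ quantum fields in a finite volume. III. Renormalization*, CMP 88 (1983)
411–445: (1.6)–(1.10) p. 413, (1.19)–(1.22) p. 416, (1.23)–(1.24) p. 417, p. 418; [Balaban1982Higgs1] CMP 85 (1982) 603–636:
(1.7), (1.11) pp. 604–605; [GlimmJaffeQP1987] J. Glimm, A. Jaffe, *Quantum Physics*, 2nd ed., Springer 1987: §8.3 (Cor. 8.3.2),
§8.4–8.5, (9.1.5).  Unit `lit-balaban-p39-g30`; v1.0 p381781 ✓ fd5ef318041e; v1.1 (gen 31) = IMPORT SWAP (BRICK 14 / BRICK 10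
by name, §1–§4 private copies deleted; every public statement byte-identical) + one header sentence corrected (referee-4 D-g95-1).
-/

noncomputable section

open scoped BigOperators InnerProductSpace Topology

namespace Literature.MathematicalPhysics.QuantumFieldTheory.Balaban1983to89.B3Eq124IndexTwoOne

open _root_.MeasureTheory _root_.Filter
open LatticeFieldCalculus B3WT223Instance B3WTPropagator B3WTCovariance B3WickVertexCalculus B3BilinearWick
  B3Eq122ChargeWick B3Eq123Counterterms B3Eq123IndexTwoOne

variable {P : Params} {j N : ℕ} (C : HiggsLattice.ChargeData N) (η w c m2 μ2 : ℝ)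

/-! ## §1–§4 (v1.1) The counterterm-curve calculus, the quotient curves, the `e = 0` moments and the Wick lemmas of
BRICK 14 `B3Eq123IndexTwoOne` §1–§8 and BRICK 10 `B3Eq123RenormalizationConditions` §1–§3 are now IMPORTED BY NAME (their
modules are built on the Lean farm since 2026-08-24T17:3xZ); v1.0 carried PRIVATE statement-identical copies of them here.  Kept
file-local: four small real-analysis helpers and the counterterm bubble `∫W₀·Σ_xη^d∣φ(x)∣²` (private in BRICK 14). -/

omit C η w c μ2 in
/-- on the ball the running mass `m² + ct(e)` stays `≥ m²/2 > 0`. [cite: Balaban1983Higgs3, (1.20) p.416] -/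
private theorem mass_pos' (hm : 0 < m2) {t : ℝ} (ht : |t| ≤ m2 / 2) : 0 < m2 + t := by
  have := neg_abs_le t
  linarith

omit C η w c m2 μ2 in
/-- membership in the ball `∣e∣ < r` in metric form. [folklore] -/
private theorem abs_lt_of_mem_ball' {r e : ℝ} (he : e ∈ Metric.ball (0 : ℝ) r) : |e| < r := by
  rwa [Metric.mem_ball, dist_zero_right, Real.norm_eq_abs] at he

omit C η w c m2 μ2 in
/-- the ball `∣e∣ < r` is a neighbourhood of each of its points. [folklore] -/
private theorem ball_mem_nhds' {r e₀ : ℝ} (he₀ : |e₀| < r) : Metric.ball (0 : ℝ) r ∈ 𝓝 e₀ :=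
  Metric.isOpen_ball.mem_nhds (by rwa [Metric.mem_ball, dist_zero_right, Real.norm_eq_abs])

omit C η w c μ2 in
/-- a ball on which the curve is controlled: `ct` twice differentiable, `ct″` continuous at `0`, `ct(0) = 0` ⇒ on some `∣e∣ < r`:
`∣ct∣ ≤ m²/2`, `∣ct′∣ ≤ B`, `∣ct″∣ ≤ B`. [folklore] -/
private theorem exists_ball_bounds' (hm : 0 < m2) {ct ct' ct'' : ℝ → ℝ} (hd : ∀ e, HasDerivAt ct (ct' e) e)
    (hd' : ∀ e, HasDerivAt ct' (ct'' e) e) (hc'' : ContinuousAt ct'' 0) (h0 : ct 0 = 0) :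
    ∃ r B : ℝ, 0 < r ∧ (∀ e, |e| < r → |ct e| ≤ m2 / 2) ∧ (∀ e, |e| < r → |ct' e| ≤ B) ∧
      (∀ e, |e| < r → |ct'' e| ≤ B) := by
  have h1 : ∀ᶠ e in 𝓝 (0:ℝ), dist (ct e) (ct 0) < m2 / 2 :=
    Metric.tendsto_nhds.mp (hd 0).continuousAt (m2 / 2) (half_pos hm)
  have h2 : ∀ᶠ e in 𝓝 (0:ℝ), dist (ct' e) (ct' 0) < 1 := Metric.tendsto_nhds.mp (hd' 0).continuousAt 1 one_pos
  have h3 : ∀ᶠ e in 𝓝 (0:ℝ), dist (ct'' e) (ct'' 0) < 1 := Metric.tendsto_nhds.mp hc'' 1 one_pos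
  obtain ⟨r, hr, hball⟩ := Metric.eventually_nhds_iff.mp (h1.and (h2.and h3))
  have hmem : ∀ e : ℝ, |e| < r → dist e 0 < r := fun e he => by rwa [Real.dist_eq, sub_zero]
  refine ⟨r, max (|ct' 0| + 1) (|ct'' 0| + 1), hr, fun e he => ?_, fun e he => ?_, fun e he => ?_⟩
  · have h := (hball (hmem e he)).1
    rw [Real.dist_eq, h0, sub_zero] at h
    exact h.le
  · have h := (hball (hmem e he)).2.1
    rw [Real.dist_eq] at h
    have := abs_sub_abs_le_abs_sub (ct' e) (ct' 0)
    exact le_max_of_le_left (by linarith)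
  · have h := (hball (hmem e he)).2.2
    rw [Real.dist_eq] at h
    have := abs_sub_abs_le_abs_sub (ct'' e) (ct'' 0)
    exact le_max_of_le_right (by linarith)


omit μ2 in
/-- the counterterm bubble `∫W₀·Σ_xη^d∣φ(x)∣² = Z₀·N·Σ_xη^dC₀(x,x)`. [cite: Balaban1983Higgs3, (1.7) p.413] -/
private theorem integral_W0_massForm (hw : 0 < w) (hm : 0 < m2) :
    ∫ φ : Cfg P j N, weight C η w c m2 (0 : VecField P j ℝ) φ * massForm w φ =
      (∫ φ : Cfg P j N, weight C η w c m2 (0 : VecField P j ℝ) φ) * ((N : ℝ) * ∑ x : Site P j, w * G w c m2 x x) := by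
  have hq : ∀ (φ : Cfg P j N) (x : Site P j),
      ‖φ x‖ ^ 2 = ⟪φ x, (1 : EuclideanSpace ℝ (Fin N) →L[ℝ] EuclideanSpace ℝ (Fin N)) (φ x)⟫_ℝ := fun φ x => by
    rw [one_apply_eq_self, real_inner_self_eq_norm_sq]
  have hint : ∀ x : Site P j, Integrable (fun φ : Cfg P j N => weight C η w c m2 (0 : VecField P j ℝ) φ *
      ⟪φ x, (1 : EuclideanSpace ℝ (Fin N) →L[ℝ] EuclideanSpace ℝ (Fin N)) (φ x)⟫_ℝ) := fun x =>
    ExpGrowth.integrable C η w c m2 hw hm (ExpGrowth.inner_op_apply x x _)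
  have htr : trE (1 : EuclideanSpace ℝ (Fin N) →L[ℝ] EuclideanSpace ℝ (Fin N)) = N := by
    unfold trE
    simp only [one_apply_eq_self, (EuclideanSpace.basisFun (Fin N) ℝ).orthonormal.1, real_inner_self_eq_norm_sq,
      one_pow, Finset.sum_const, Finset.card_univ, Fintype.card_fin, nsmul_eq_mul, mul_one]
  unfold massForm
  simp_rw [hq, Finset.mul_sum]
  have hre : ∀ φ : Cfg P j N, (∑ x : Site P j, weight C η w c m2 (0 : VecField P j ℝ) φ *
      (w * ⟪φ x, (1 : EuclideanSpace ℝ (Fin N) →L[ℝ] EuclideanSpace ℝ (Fin N)) (φ x)⟫_ℝ)) =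
      ∑ x : Site P j, w * (weight C η w c m2 (0 : VecField P j ℝ) φ *
        ⟪φ x, (1 : EuclideanSpace ℝ (Fin N) →L[ℝ] EuclideanSpace ℝ (Fin N)) (φ x)⟫_ℝ) := fun φ =>
    Finset.sum_congr rfl fun x _ => by ring
  simp_rw [hre]
  rw [integral_finsetSum _ fun x _ => (hint x).const_mul w]
  simp_rw [integral_const_mul, moment2_op C η w c m2 hw hm, htr]
  exact Finset.sum_congr rfl fun x _ => by ring

/-! ## §5 ONE-SIDED DIFFERENTIATION IN THE QUARTIC COUPLING UNDER `∫dA dφ`, AT ANY CHARGE `e` (the joint-measure twin of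
BRICK 1's `hasDerivWithinAt_gaussInt_exp_neg_of_le`, same dominated-convergence proof on the difference quotients
`∣(e^{−λV} − 1)/λ∣ ≤ ∣V∣`): for `V ≥ −K` and `F` of exponential-linear growth, `λ ↦ ∫dA dφ e^{−S^ε_{e,M}}e^{−λV}F` (`λ ≥ 0`) has
right-derivative `−∫dA dφ e^{−S^ε_{e,M}}VF` at `λ = 0⁺`, and `(∂/∂λ)⁺log∫dA dφ e^{−S^ε_{e,M}}e^{−λV}∣_{λ=0} = −⟨V⟩_{e,M}` — one-sided
because `e^{−λΣ∣φ∣⁴}` is not integrable for `λ < 0` (the typer's repair `E1of124R` of (1.24): right `λ`-derivatives) -/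

omit C η w c m2 μ2 in
/-- `∣e^{−t} − 1∣ ≤ t` for `t ≥ 0`. [folklore] -/
private theorem abs_exp_neg_sub_one_le {t : ℝ} (ht : 0 ≤ t) : |Real.exp (-t) - 1| ≤ t := by
  have h1 : Real.exp (-t) ≤ 1 := Real.exp_le_one_iff.mpr (by linarith)
  have h2 : 1 - t ≤ Real.exp (-t) := by linarith [Real.add_one_le_exp (-t)]
  rw [abs_sub_comm, abs_of_nonneg (by linarith)]
  linarith

omit C η w c m2 μ2 in
/-- for `λ ≥ 0` and `V ≥ 0` the Boltzmann factor is a bounded continuous multiplier: `e^{−λV}F` is of exponential-linear growth.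
[cite: GlimmJaffeQP1987, §8.4–8.5] -/
private theorem expGrowth_exp_neg_mul {V F : Cfg P j N → ℝ} (hV : ExpGrowth V) (hV0 : ∀ φ, 0 ≤ V φ) (hF : ExpGrowth F)
    {lam : ℝ} (hlam : 0 ≤ lam) : ExpGrowth (fun φ : Cfg P j N => Real.exp (-(lam * V φ)) * F φ) := by
  obtain ⟨hFc, K, κ, hK, hκ, hFb⟩ := id hF
  refine ⟨((continuous_const.mul hV.1).neg.rexp).mul hFc, K, κ, hK, hκ, fun φ => ?_⟩
  rw [abs_mul, abs_of_pos (Real.exp_pos _)]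
  have h1 : Real.exp (-(lam * V φ)) ≤ 1 := Real.exp_le_one_iff.mpr (by nlinarith [hV0 φ])
  calc Real.exp (-(lam * V φ)) * |F φ| ≤ 1 * |F φ| := mul_le_mul_of_nonneg_right h1 (abs_nonneg _)
    _ ≤ K * Real.exp (κ * ‖φ‖) := by rw [one_mul]; exact hFb φ

omit m2 in
/-- **one-sided dominated differentiation in `λ` under `∫dA dφ` at charge `e`, mass `M`**: for `V ≥ 0` and `F` of
exponential-linear growth (observables of the scalar field), `λ ↦ ∫dA dφ e^{−S^ε_{e,M}(A,φ)}e^{−λV(φ)}F(φ)` (`λ ≥ 0`) has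
right-derivative `−∫dA dφ e^{−S^ε_{e,M}}VF` at `λ = 0⁺`. [cite: Balaban1983Higgs3, (1.19)–(1.20) p.416, (1.24) p.417]
[cite: GlimmJaffeQP1987, §8.4–8.5] -/
theorem hasDerivWithinAt_integral_J_exp_neg (hw : 0 < w) {M : ℝ} (hM : 0 < M) (hμ : 0 < μ2) {V F : Cfg P j N → ℝ}
    (hV : ExpGrowth V) (hV0 : ∀ φ, 0 ≤ V φ) (hF : ExpGrowth F) (e : ℝ) :
    HasDerivWithinAt (fun lam : ℝ => ∫ p : JCfg P j N, J C η w c M μ2 e p * (Real.exp (-(lam * V p.2)) * F p.2))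
      (-(∫ p : JCfg P j N, J C η w c M μ2 e p * (V p.2 * F p.2))) (Set.Ici 0) 0 := by
  have hJF : Integrable (fun p : JCfg P j N => J C η w c M μ2 e p * F p.2) := integrable_J_mul C η w c M μ2 hw hM hμ hF e
  have hJVF : Integrable (fun p : JCfg P j N => J C η w c M μ2 e p * (V p.2 * F p.2)) :=
    integrable_J_mul C η w c M μ2 hw hM hμ (hV.mul hF) e
  have hIlam : ∀ lam : ℝ, 0 ≤ lam →
      Integrable (fun p : JCfg P j N => J C η w c M μ2 e p * (Real.exp (-(lam * V p.2)) * F p.2)) := fun lam hlam =>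
    integrable_J_mul C η w c M μ2 hw hM hμ (expGrowth_exp_neg_mul hV hV0 hF hlam) e
  have hI : Set.Ici (0 : ℝ) \ {0} = Set.Ioi 0 := by
    ext t
    simp only [Set.mem_sdiff, Set.mem_Ici, Set.mem_singleton_iff, Set.mem_Ioi]
    exact ⟨fun h => lt_of_le_of_ne h.1 (Ne.symm h.2), fun h => ⟨h.le, h.ne'⟩⟩
  -- the difference-quotient integrand
  have hpt : ∀ (lam : ℝ) (p : JCfg P j N),
      (J C η w c M μ2 e p * (Real.exp (-(lam * V p.2)) * F p.2) - J C η w c M μ2 e p * F p.2) / lam =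
        J C η w c M μ2 e p * (F p.2 * ((Real.exp (-(lam * V p.2)) - 1) / lam)) := fun lam p => by
    rw [div_eq_mul_inv, div_eq_mul_inv]; ring
  rw [hasDerivWithinAt_iff_tendsto_slope, hI]
  have hslope : ∀ lam : ℝ, 0 < lam →
      slope (fun lam : ℝ => ∫ p : JCfg P j N, J C η w c M μ2 e p * (Real.exp (-(lam * V p.2)) * F p.2)) 0 lam =
        ∫ p : JCfg P j N, J C η w c M μ2 e p * (F p.2 * ((Real.exp (-(lam * V p.2)) - 1) / lam)) := by
    intro lam hlam
    rw [slope_def_field, sub_zero]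
    have e0 : (fun p : JCfg P j N => J C η w c M μ2 e p * (Real.exp (-(0 * V p.2)) * F p.2)) =
        fun p => J C η w c M μ2 e p * F p.2 := by
      funext p; rw [zero_mul, neg_zero, Real.exp_zero, one_mul]
    simp only [e0]
    rw [← integral_sub (hIlam lam hlam.le) hJF, ← integral_div]
    exact integral_congr_ae (Filter.Eventually.of_forall fun p => hpt lam p)
  have hev : (fun lam => ∫ p : JCfg P j N, J C η w c M μ2 e p * (F p.2 * ((Real.exp (-(lam * V p.2)) - 1) / lam)))
      =ᶠ[𝓝[Set.Ioi (0 : ℝ)] 0]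
      slope (fun lam : ℝ => ∫ p : JCfg P j N, J C η w c M μ2 e p * (Real.exp (-(lam * V p.2)) * F p.2)) 0 :=
    eventually_nhdsWithin_of_forall fun lam hlam => (hslope lam hlam).symm
  refine Filter.Tendsto.congr' hev ?_
  have hlim : (-(∫ p : JCfg P j N, J C η w c M μ2 e p * (V p.2 * F p.2))) =
      ∫ p : JCfg P j N, J C η w c M μ2 e p * (F p.2 * (-V p.2)) := by
    rw [← integral_neg]
    exact integral_congr_ae (Filter.Eventually.of_forall fun p => by ring)
  rw [hlim]
  refine tendsto_integral_filter_of_dominated_convergence (fun p => ‖J C η w c M μ2 e p * (V p.2 * F p.2)‖) ?_ ?_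
    hJVF.norm ?_
  · refine eventually_nhdsWithin_of_forall fun lam (hlam : 0 < lam) => ?_
    exact (((hIlam lam hlam.le).sub hJF).div_const lam).aestronglyMeasurable.congr
      (Filter.Eventually.of_forall fun p => hpt lam p)
  · refine eventually_nhdsWithin_of_forall fun lam (hlam : 0 < lam) => Filter.Eventually.of_forall fun p => ?_
    have hq : |(Real.exp (-(lam * V p.2)) - 1) / lam| ≤ |V p.2| := by
      rw [abs_div, abs_of_pos hlam, div_le_iff₀ hlam, abs_of_nonneg (hV0 p.2)]
      have := abs_exp_neg_sub_one_le (t := lam * V p.2) (by nlinarith [hV0 p.2])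
      linarith [mul_comm lam (V p.2)]
    rw [Real.norm_eq_abs, Real.norm_eq_abs, abs_mul, abs_mul, abs_mul, abs_mul]
    have hJn : 0 ≤ |J C η w c M μ2 e p| := abs_nonneg _
    calc |J C η w c M μ2 e p| * (|F p.2| * |(Real.exp (-(lam * V p.2)) - 1) / lam|)
        ≤ |J C η w c M μ2 e p| * (|F p.2| * |V p.2|) :=
          mul_le_mul_of_nonneg_left (mul_le_mul_of_nonneg_left hq (abs_nonneg _)) hJn
      _ = |J C η w c M μ2 e p| * (|V p.2| * |F p.2|) := by ring
  · refine Filter.Eventually.of_forall fun p => ?_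
    have hd : HasDerivAt (fun lam : ℝ => Real.exp (-(lam * V p.2))) (-V p.2) 0 := by
      have h1 : HasDerivAt (fun lam : ℝ => -(lam * V p.2)) (-(1 * V p.2)) 0 := ((hasDerivAt_id 0).mul_const (V p.2)).neg
      have h2 : HasDerivAt (fun lam : ℝ => Real.exp (-(lam * V p.2))) (Real.exp (-(0 * V p.2)) * -(1 * V p.2)) 0 :=
        h1.exp
      simpa using h2
    have ht : Tendsto (slope (fun lam : ℝ => Real.exp (-(lam * V p.2))) 0) (𝓝[Set.Ioi (0:ℝ)] 0) (𝓝 (-V p.2)) := by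
      have h := hasDerivAt_iff_tendsto_slope.mp hd
      exact h.mono_left (nhdsWithin_mono _ fun t (ht : 0 < t) => ne_of_gt ht)
    have ht' : Tendsto (fun lam : ℝ => (Real.exp (-(lam * V p.2)) - 1) / lam) (𝓝[Set.Ioi (0:ℝ)] 0) (𝓝 (-V p.2)) := by
      refine ht.congr' (eventually_nhdsWithin_of_forall fun lam hlam => ?_)
      rw [slope_def_field, sub_zero, zero_mul, neg_zero, Real.exp_zero]
    exact (ht'.const_mul (F p.2)).const_mul (J C η w c M μ2 e p)

omit m2 in
/-- **interactions bounded below** (`V ≥ −K`; the Wick-ordered quartic is not positive): `λ ↦ ∫dA dφ e^{−S^ε_{e,M}}e^{−λV}F` has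
right-derivative `−∫dA dφ e^{−S^ε_{e,M}}VF` at `λ = 0⁺` (`e^{−λV} = e^{λK}e^{−λ(V+K)}`). [cite: Balaban1983Higgs3, (1.20) p.416,
(1.24) p.417] [cite: GlimmJaffeQP1987, §8.4–8.5] -/
theorem hasDerivWithinAt_integral_J_exp_neg_of_le (hw : 0 < w) {M : ℝ} (hM : 0 < M) (hμ : 0 < μ2) {V F : Cfg P j N → ℝ}
    (hV : ExpGrowth V) {K : ℝ} (hVK : ∀ φ, -K ≤ V φ) (hF : ExpGrowth F) (e : ℝ) :
    HasDerivWithinAt (fun lam : ℝ => ∫ p : JCfg P j N, J C η w c M μ2 e p * (Real.exp (-(lam * V p.2)) * F p.2))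
      (-(∫ p : JCfg P j N, J C η w c M μ2 e p * (V p.2 * F p.2))) (Set.Ici 0) 0 := by
  have hV' : ExpGrowth (fun φ : Cfg P j N => V φ + K) := hV.add (ExpGrowth.const K)
  have hV'0 : ∀ φ : Cfg P j N, 0 ≤ V φ + K := fun φ => by linarith [hVK φ]
  have h := hasDerivWithinAt_integral_J_exp_neg C η w c μ2 hw hM hμ hV' hV'0 hF e
  have hJF : Integrable (fun p : JCfg P j N => J C η w c M μ2 e p * F p.2) := integrable_J_mul C η w c M μ2 hw hM hμ hF e
  have hJVF : Integrable (fun p : JCfg P j N => J C η w c M μ2 e p * (V p.2 * F p.2)) :=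
    integrable_J_mul C η w c M μ2 hw hM hμ (hV.mul hF) e
  have hexp : HasDerivWithinAt (fun lam : ℝ => Real.exp (lam * K)) K (Set.Ici 0) 0 := by
    have h1 : HasDerivAt (fun lam : ℝ => lam * K) K 0 := hasDerivAt_mul_const K
    have h2 := h1.exp
    simp only [zero_mul, Real.exp_zero, one_mul] at h2
    exact h2.hasDerivWithinAt
  have hfun : (fun lam : ℝ => ∫ p : JCfg P j N, J C η w c M μ2 e p * (Real.exp (-(lam * V p.2)) * F p.2))
      = fun lam => Real.exp (lam * K) *
          ∫ p : JCfg P j N, J C η w c M μ2 e p * (Real.exp (-(lam * (V p.2 + K))) * F p.2) := by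
    funext lam
    rw [← integral_const_mul]
    refine integral_congr_ae (Filter.Eventually.of_forall fun p => ?_)
    show J C η w c M μ2 e p * (Real.exp (-(lam * V p.2)) * F p.2)
        = Real.exp (lam * K) * (J C η w c M μ2 e p * (Real.exp (-(lam * (V p.2 + K))) * F p.2))
    have e1 : Real.exp (-(lam * V p.2)) = Real.exp (lam * K) * Real.exp (-(lam * (V p.2 + K))) := by
      rw [← Real.exp_add]; congr 1; ring
    rw [e1]; ring
  rw [hfun]
  refine (hexp.mul h).congr_deriv ?_
  simp only [zero_mul, neg_zero, Real.exp_zero, one_mul]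
  have hsplit : (∫ p : JCfg P j N, J C η w c M μ2 e p * ((V p.2 + K) * F p.2)) =
      (∫ p : JCfg P j N, J C η w c M μ2 e p * (V p.2 * F p.2)) + K * ∫ p : JCfg P j N, J C η w c M μ2 e p * F p.2 := by
    have hKJF : Integrable (fun p : JCfg P j N => K * (J C η w c M μ2 e p * F p.2)) := hJF.const_mul K
    rw [← integral_const_mul, ← integral_add hJVF hKJF]
    refine integral_congr_ae (Filter.Eventually.of_forall fun p => ?_)
    show J C η w c M μ2 e p * ((V p.2 + K) * F p.2) = J C η w c M μ2 e p * (V p.2 * F p.2) + K * (J C η w c M μ2 e p * F p.2)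
    ring
  rw [hsplit]
  ring

omit m2 in
/-- **THE RIGHT `λ`-DERIVATIVE OF `log Z` AT `0⁺` AT CHARGE `e`**: for `V ≥ −K` of exponential-linear growth,
`(∂/∂λ)⁺ log∫dA dφ e^{−S^ε_{e,M}}e^{−λV}∣_{λ=0} = −∫e^{−S^ε_{e,M}}V / ∫e^{−S^ε_{e,M}} = −⟨V⟩_{e,M}` (first-order perturbation theory in
`λ` at fixed charge: the expectation of the interaction). [cite: Balaban1983Higgs3, (1.20) p.416, (1.24) p.417]
[cite: GlimmJaffeQP1987, §8.4–8.5] -/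
theorem hasDerivWithinAt_log_integral_J_exp_neg (hw : 0 < w) {M : ℝ} (hM : 0 < M) (hμ : 0 < μ2) {V : Cfg P j N → ℝ}
    (hV : ExpGrowth V) {K : ℝ} (hVK : ∀ φ, -K ≤ V φ) (e : ℝ) :
    HasDerivWithinAt (fun lam : ℝ => Real.log (∫ p : JCfg P j N, J C η w c M μ2 e p * Real.exp (-(lam * V p.2))))
      (-(∫ p : JCfg P j N, J C η w c M μ2 e p * V p.2) / ∫ p : JCfg P j N, J C η w c M μ2 e p) (Set.Ici 0) 0 := by
  have h := hasDerivWithinAt_integral_J_exp_neg_of_le C η w c μ2 hw hM hμ hV hVK (ExpGrowth.const 1) e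
  have e1 : (fun lam : ℝ => ∫ p : JCfg P j N, J C η w c M μ2 e p * (Real.exp (-(lam * V p.2)) * (1 : ℝ))) =
      fun lam => ∫ p : JCfg P j N, J C η w c M μ2 e p * Real.exp (-(lam * V p.2)) := by
    funext lam; simp only [mul_one]
  have e2 : (∫ p : JCfg P j N, J C η w c M μ2 e p * (V p.2 * (1 : ℝ))) = ∫ p : JCfg P j N, J C η w c M μ2 e p * V p.2 := by
    simp only [mul_one]
  rw [e1, e2] at h
  have hZ : 0 < ∫ p : JCfg P j N, J C η w c M μ2 e p := integral_J_pos C η w c M μ2 hw hM hμ e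
  have hval : (∫ p : JCfg P j N, J C η w c M μ2 e p * Real.exp (-(0 * V p.2))) = ∫ p : JCfg P j N, J C η w c M μ2 e p := by
    simp only [zero_mul, neg_zero, Real.exp_zero, mul_one]
  have hne : (∫ p : JCfg P j N, J C η w c M μ2 e p * Real.exp (-(0 * V p.2))) ≠ 0 := by rw [hval]; exact hZ.ne'
  have hl := h.log hne
  refine hl.congr_deriv ?_
  rw [hval]

omit m2 in
/-- the value: `derivWithin (λ ↦ log∫dA dφ e^{−S^ε_{e,M}}e^{−λV}) [0,∞) 0 = −∫e^{−S^ε_{e,M}}V / ∫e^{−S^ε_{e,M}}`.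
[cite: Balaban1983Higgs3, (1.20) p.416, (1.24) p.417] -/
theorem derivWithin_log_integral_J_exp_neg (hw : 0 < w) {M : ℝ} (hM : 0 < M) (hμ : 0 < μ2) {V : Cfg P j N → ℝ}
    (hV : ExpGrowth V) {K : ℝ} (hVK : ∀ φ, -K ≤ V φ) (e : ℝ) :
    derivWithin (fun lam : ℝ => Real.log (∫ p : JCfg P j N, J C η w c M μ2 e p * Real.exp (-(lam * V p.2))))
      (Set.Ici 0) 0 = -(∫ p : JCfg P j N, J C η w c M μ2 e p * V p.2) / ∫ p : JCfg P j N, J C η w c M μ2 e p :=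
  (hasDerivWithinAt_log_integral_J_exp_neg C η w c μ2 hw hM hμ hV hVK e).derivWithin
    (uniqueDiffOn_Ici (0 : ℝ) 0 Set.self_mem_Ici)


/-! ## §6 `log Z^{ct}(e,λ)`: THE PARTITION FUNCTION OF (1.24) FOR THE ACTION (1.20) WITH `δm² = δm²_{(2,0)}e² + δm²_{(0,1)}λ +
δm²_{(2,1)}e²λ + δm²_{(4,0)}e⁴` INSERTED (`λ ≥ 0`; the letters `d20, d01, d21, d40` = `δm²_{(2,0)}, δm²_{(0,1)}, δm²_{(2,1)},
δm²_{(4,0)}`), `Z^{ct}(e,λ) = ∫dA dφ e^{−S^ε_{e, m²+δm²(e,λ)}(A,φ)}e^{−λΣ_yη^d∣φ(y)∣⁴}`, read in the body-of-record order of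
`B3Sect1TwoPoint.E1of124R` (typer g30's `B3Eq124OneSidedBridge`): the RIGHT `λ`-derivative at `0⁺` FIRST, at every charge `e`
near `0` — its value is `−⟨U + ½δm²_{(2,1)}e²Q⟩_e`, the expectation of the order-`λ` part of the action in the measure at charge
`e`, `λ = 0`, mass `M_e = m² + δm²_{(2,0)}e² + δm²_{(4,0)}e⁴` (`U = Σ_yη^d∣φ(y)∣⁴ + ½δm²_{(0,1)}Q`, `Q = Σ_yη^d∣φ(y)∣²`) -/

/-- **the fibre over the charge**: at fixed `e` the `λ`-dependent part of the counterterm joins the quartic term in the Boltzmann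
factor, `∫dA dφ e^{−S^ε_{e, m²+δm²(e,λ)}}e^{−λΣη^d∣φ∣⁴} = ∫dA dφ e^{−S^ε_{e, M_e}}e^{−λ(U + ½δm²_{(2,1)}e²Q)}` (the counterterm is a
mass shift: `e^{−S_{M+t}} = e^{−S_M}e^{−½tQ}`, `t = (δm²_{(0,1)} + δm²_{(2,1)}e²)λ`). [cite: Balaban1983Higgs3, (1.20) p.416,
(1.23)–(1.24) p.417] -/
theorem Zct_fibre (d20 d01 d21 d40 e lam : ℝ) {U : Cfg P j N → ℝ}
    (hU : ∀ φ, U φ = (∑ y : Site P j, w * ‖φ y‖ ^ 4) + 1 / 2 * d01 * massForm w φ) :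
    (∫ p : JCfg P j N, J C η w c (m2 + (d20 * e ^ 2 + d01 * lam + d21 * (e ^ 2 * lam) + d40 * e ^ 4)) μ2 e p *
        Real.exp (-(lam * ∑ y : Site P j, w * ‖p.2 y‖ ^ 4))) =
      ∫ p : JCfg P j N, J C η w c (m2 + (d20 * e ^ 2 + d40 * e ^ 4)) μ2 e p *
        Real.exp (-(lam * (U p.2 + 1 / 2 * (d21 * e ^ 2) * massForm w p.2))) := by
  refine integral_congr_ae (Filter.Eventually.of_forall fun p => ?_)
  have hm : m2 + (d20 * e ^ 2 + d01 * lam + d21 * (e ^ 2 * lam) + d40 * e ^ 4) =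
      (m2 + (d20 * e ^ 2 + d40 * e ^ 4)) + (d01 + d21 * e ^ 2) * lam := by ring
  dsimp only
  rw [hm, B3Eq123RenormalizationConditions.J_mass_add C η w c (m2 + (d20 * e ^ 2 + d40 * e ^ 4)) μ2 ((d01 + d21 * e ^ 2) * lam) e p, hU, mul_assoc,
    ← Real.exp_add]
  congr 1
  congr 1
  ring

omit C η c m2 μ2 in
/-- `U + ½δm²_{(2,1)}e²Q = Σ_yη^d∣φ(y)∣⁴ + ½(δm²_{(0,1)} + δm²_{(2,1)}e²)Q` is bounded below (§4 `neg_le_U` at the shifted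
coefficient). [cite: Balaban1983Higgs3, (1.20) p.416, (1.23) p.417] -/
theorem neg_le_Ue (hw : 0 ≤ w) (d01 d21 e : ℝ) {U : Cfg P j N → ℝ}
    (hU : ∀ φ, U φ = (∑ y : Site P j, w * ‖φ y‖ ^ 4) + 1 / 2 * d01 * massForm w φ) (φ : Cfg P j N) :
    -(Fintype.card (Site P j) * (w * (d01 + d21 * e ^ 2) ^ 2 / 16)) ≤ U φ + 1 / 2 * (d21 * e ^ 2) * massForm w φ :=
  neg_le_U w hw (d01 + d21 * e ^ 2) (U := fun φ => U φ + 1 / 2 * (d21 * e ^ 2) * massForm w φ)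
    (fun φ => by rw [hU]; ring) φ

omit C η c m2 μ2 in
/-- `U + ½δm²_{(2,1)}e²Q` is an observable of exponential-linear growth. [cite: Balaban1983Higgs3, (1.20) p.416] -/
theorem expGrowth_Ue (d01 d21 e : ℝ) {U : Cfg P j N → ℝ}
    (hU : ∀ φ, U φ = (∑ y : Site P j, w * ‖φ y‖ ^ 4) + 1 / 2 * d01 * massForm w φ) :
    ExpGrowth (fun φ : Cfg P j N => U φ + 1 / 2 * (d21 * e ^ 2) * massForm w φ) :=
  (expGrowth_U w d01 hU).add ((B3Eq123RenormalizationConditions.expGrowth_massForm (P := P) (j := j) (N := N) w).const_mul _)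

/-- **THE INNER DERIVATIVE OF THE BODY OF RECORD: the right `λ`-derivative of `log Z^{ct}(e,·)` at `0⁺`, at every charge `e` with
`∣δm²_{(2,0)}e² + δm²_{(4,0)}e⁴∣ ≤ m²/2`** (so that `M_e > 0`): `(∂/∂λ)⁺log Z^{ct}(e,λ)∣_{λ=0} = −⟨U + ½δm²_{(2,1)}e²Q⟩_e`,
`⟨F⟩_e = ∫dA dφ e^{−S^ε_{e,M_e}}F / ∫dA dφ e^{−S^ε_{e,M_e}}` — first-order perturbation theory in `λ` at fixed charge (§5's one-sided
dominated differentiation; the interaction is bounded below, not positive). [cite: Balaban1983Higgs3, (1.20) p.416, (1.24) p.417]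
[cite: GlimmJaffeQP1987, §8.4–8.5] -/
theorem hasDerivWithinAt_logZct_lam (hw : 0 < w) (hm : 0 < m2) (hμ : 0 < μ2) (d20 d01 d21 d40 : ℝ) {U : Cfg P j N → ℝ}
    (hU : ∀ φ, U φ = (∑ y : Site P j, w * ‖φ y‖ ^ 4) + 1 / 2 * d01 * massForm w φ) {e : ℝ}
    (he : |d20 * e ^ 2 + d40 * e ^ 4| ≤ m2 / 2) :
    HasDerivWithinAt (fun lam : ℝ => Real.log (∫ p : JCfg P j N,
        J C η w c (m2 + (d20 * e ^ 2 + d01 * lam + d21 * (e ^ 2 * lam) + d40 * e ^ 4)) μ2 e p *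
          Real.exp (-(lam * ∑ y : Site P j, w * ‖p.2 y‖ ^ 4))))
      (-(∫ p : JCfg P j N, J C η w c (m2 + (d20 * e ^ 2 + d40 * e ^ 4)) μ2 e p *
            (U p.2 + 1 / 2 * (d21 * e ^ 2) * massForm w p.2)) /
        ∫ p : JCfg P j N, J C η w c (m2 + (d20 * e ^ 2 + d40 * e ^ 4)) μ2 e p) (Set.Ici 0) 0 := by
  have hfun : (fun lam : ℝ => Real.log (∫ p : JCfg P j N,
        J C η w c (m2 + (d20 * e ^ 2 + d01 * lam + d21 * (e ^ 2 * lam) + d40 * e ^ 4)) μ2 e p *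
          Real.exp (-(lam * ∑ y : Site P j, w * ‖p.2 y‖ ^ 4)))) =
      fun lam => Real.log (∫ p : JCfg P j N, J C η w c (m2 + (d20 * e ^ 2 + d40 * e ^ 4)) μ2 e p *
        Real.exp (-(lam * (U p.2 + 1 / 2 * (d21 * e ^ 2) * massForm w p.2)))) := by
    funext lam; rw [Zct_fibre C η w c m2 μ2 d20 d01 d21 d40 e lam hU]
  rw [hfun]
  exact hasDerivWithinAt_log_integral_J_exp_neg C η w c μ2 hw (mass_pos' m2 hm he) hμ (expGrowth_Ue w d01 d21 e hU)
    (neg_le_Ue w hw.le d01 d21 e hU) e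

/-- the value: **`iteratedDerivWithin 1 (λ ↦ log Z^{ct}(e,λ)) [0,∞) 0 = −⟨U + ½δm²_{(2,1)}e²Q⟩_e`** for every `e` with `M_e − m² ≤ m²/2`
in absolute value (`[0,∞)` has the unique-differentiability property at `0`). [cite: Balaban1983Higgs3, (1.20) p.416, (1.24) p.417] -/
theorem iteratedDerivWithin_one_logZct (hw : 0 < w) (hm : 0 < m2) (hμ : 0 < μ2) (d20 d01 d21 d40 : ℝ) {U : Cfg P j N → ℝ}
    (hU : ∀ φ, U φ = (∑ y : Site P j, w * ‖φ y‖ ^ 4) + 1 / 2 * d01 * massForm w φ) {e : ℝ}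
    (he : |d20 * e ^ 2 + d40 * e ^ 4| ≤ m2 / 2) :
    iteratedDerivWithin 1 (fun lam : ℝ => Real.log (∫ p : JCfg P j N,
        J C η w c (m2 + (d20 * e ^ 2 + d01 * lam + d21 * (e ^ 2 * lam) + d40 * e ^ 4)) μ2 e p *
          Real.exp (-(lam * ∑ y : Site P j, w * ‖p.2 y‖ ^ 4)))) (Set.Ici 0) 0 =
      -(∫ p : JCfg P j N, J C η w c (m2 + (d20 * e ^ 2 + d40 * e ^ 4)) μ2 e p *
            (U p.2 + 1 / 2 * (d21 * e ^ 2) * massForm w p.2)) /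
        ∫ p : JCfg P j N, J C η w c (m2 + (d20 * e ^ 2 + d40 * e ^ 4)) μ2 e p := by
  rw [iteratedDerivWithin_one]
  exact (hasDerivWithinAt_logZct_lam C η w c m2 μ2 hw hm hμ d20 d01 d21 d40 hU he).derivWithin
    (uniqueDiffOn_Ici (0 : ℝ) 0 Set.self_mem_Ici)

omit C η w c m2 μ2 in
/-- the `λ = 0` counterterm curve `c(e) = δm²_{(2,0)}e² + δm²_{(4,0)}e⁴` and its first two derivatives. [folklore] -/
private theorem hasDerivAt_c20 (d20 d40 e : ℝ) :
    HasDerivAt (fun s : ℝ => d20 * s ^ 2 + d40 * s ^ 4) (2 * d20 * e + 4 * d40 * e ^ 3) e := by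
  have h := ((hasDerivAt_pow 2 e).const_mul d20).add ((hasDerivAt_pow 4 e).const_mul d40)
  refine h.congr_deriv ?_
  simp only [Nat.cast_ofNat]
  ring

omit C η w c m2 μ2 in
/-- `c′(e) = 2δm²_{(2,0)}e + 4δm²_{(4,0)}e³` has derivative `c″(e) = 2δm²_{(2,0)} + 12δm²_{(4,0)}e²`. [folklore] -/
private theorem hasDerivAt_c20' (d20 d40 e : ℝ) :
    HasDerivAt (fun s : ℝ => 2 * d20 * s + 4 * d40 * s ^ 3) (2 * d20 + 12 * d40 * e ^ 2) e := by
  have h := ((hasDerivAt_id e).const_mul (2 * d20)).add ((hasDerivAt_pow 3 e).const_mul (4 * d40))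
  refine h.congr_deriv ?_
  simp only [Nat.cast_ofNat]
  ring

omit C η w c μ2 in
/-- a ball `∣e∣ < r` on which `∣c(e)∣ ≤ m²/2` and `c′, c″` are bounded. [folklore] -/
private theorem exists_ball_c20 (hm : 0 < m2) (d20 d40 : ℝ) :
    ∃ r B : ℝ, 0 < r ∧ (∀ e, |e| < r → |d20 * e ^ 2 + d40 * e ^ 4| ≤ m2 / 2) ∧
      (∀ e, |e| < r → |2 * d20 * e + 4 * d40 * e ^ 3| ≤ B) ∧ (∀ e, |e| < r → |2 * d20 + 12 * d40 * e ^ 2| ≤ B) :=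
  exists_ball_bounds' m2 hm (ct := fun s => d20 * s ^ 2 + d40 * s ^ 4) (ct' := fun s => 2 * d20 * s + 4 * d40 * s ^ 3)
    (ct'' := fun s => 2 * d20 + 12 * d40 * s ^ 2) (hasDerivAt_c20 d20 d40) (hasDerivAt_c20' d20 d40)
    (continuous_const.add (continuous_const.mul (continuous_pow 2))).continuousAt (by ring)

/-- **NEAR `e = 0` THE INNER DERIVATIVE IS A COMBINATION OF §2's QUOTIENT CURVES** (`F₀ = 1`): on the ball where `∣c(e)∣ ≤ m²/2`,
`iteratedDerivWithin 1 (λ ↦ log Z^{ct}(e,λ)) [0,∞) 0 = −N_U(e)/Z(e) − ½δm²_{(2,1)}e²·N_Q(e)/Z(e)`, `N_F(e) = ∫dA dφ e^{−S^ε_{e,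
m²+c(e)}}F`, `Z = N_1` — an eventual equality of functions of `e` at `0`, which is all the outer `iteratedDeriv 2 · 0` sees.
[cite: Balaban1983Higgs3, (1.20) p.416, (1.24) p.417] -/
theorem iteratedDerivWithin_one_logZct_eventuallyEq (hw : 0 < w) (hm : 0 < m2) (hμ : 0 < μ2) (d20 d01 d21 d40 : ℝ)
    {U : Cfg P j N → ℝ} (hU : ∀ φ, U φ = (∑ y : Site P j, w * ‖φ y‖ ^ 4) + 1 / 2 * d01 * massForm w φ) :
    (fun e : ℝ => iteratedDerivWithin 1 (fun lam : ℝ => Real.log (∫ p : JCfg P j N,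
        J C η w c (m2 + (d20 * e ^ 2 + d01 * lam + d21 * (e ^ 2 * lam) + d40 * e ^ 4)) μ2 e p *
          Real.exp (-(lam * ∑ y : Site P j, w * ‖p.2 y‖ ^ 4)))) (Set.Ici 0) 0) =ᶠ[𝓝 0]
      fun e => -((∫ p : JCfg P j N, J C η w c (m2 + (d20 * e ^ 2 + d40 * e ^ 4)) μ2 e p * U p.2) /
            ∫ p : JCfg P j N, J C η w c (m2 + (d20 * e ^ 2 + d40 * e ^ 4)) μ2 e p * (1 : ℝ))
        - 1 / 2 * d21 * e ^ 2 *
          ((∫ p : JCfg P j N, J C η w c (m2 + (d20 * e ^ 2 + d40 * e ^ 4)) μ2 e p * massForm w p.2) /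
            ∫ p : JCfg P j N, J C η w c (m2 + (d20 * e ^ 2 + d40 * e ^ 4)) μ2 e p * (1 : ℝ)) := by
  obtain ⟨r, B, hr, hc, -, -⟩ := exists_ball_c20 m2 hm d20 d40
  have h00 : |(0 : ℝ)| < r := by rwa [abs_zero]
  refine Filter.eventually_of_mem (ball_mem_nhds' h00) fun e he => ?_
  have he' := hc e (abs_lt_of_mem_ball' he)
  dsimp only
  rw [iteratedDerivWithin_one_logZct C η w c m2 μ2 hw hm hμ d20 d01 d21 d40 hU he']
  have hUg := expGrowth_U w d01 hU
  have hmF := B3Eq123RenormalizationConditions.expGrowth_massForm (P := P) (j := j) (N := N) w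
  have hM := mass_pos' m2 hm he'
  have i1 := integrable_J_mul C η w c (m2 + (d20 * e ^ 2 + d40 * e ^ 4)) μ2 hw hM hμ hUg e
  have i2 := integrable_J_mul C η w c (m2 + (d20 * e ^ 2 + d40 * e ^ 4)) μ2 hw hM hμ hmF e
  have hsplit : (∫ p : JCfg P j N, J C η w c (m2 + (d20 * e ^ 2 + d40 * e ^ 4)) μ2 e p *
      (U p.2 + 1 / 2 * (d21 * e ^ 2) * massForm w p.2)) =
      (∫ p : JCfg P j N, J C η w c (m2 + (d20 * e ^ 2 + d40 * e ^ 4)) μ2 e p * U p.2)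
        + 1 / 2 * d21 * e ^ 2 * ∫ p : JCfg P j N, J C η w c (m2 + (d20 * e ^ 2 + d40 * e ^ 4)) μ2 e p * massForm w p.2 := by
    rw [← integral_const_mul, ← integral_add i1 (i2.const_mul _)]
    exact integral_congr_ae (Filter.Eventually.of_forall fun p => by dsimp only; ring)
  rw [hsplit]
  simp only [mul_one]
  ring


/-! ## §7 THE OUTER DERIVATIVE: `iteratedDeriv 2` IN THE CHARGE AT `0` of the inner derivative `g(e) = −N_U(e)/Z(e) −
½δm²_{(2,1)}e²·N_Q(e)/Z(e)` — §2's quotient curves are differentiable on a ball and their derivatives differentiable at `0`, so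
`g″(0) = −(N_U/Z)″(0) − δm²_{(2,1)}·N_Q(0)/Z(0)` (the factor `e²` kills every other term of the second summand at `e = 0`) -/

omit C η w c m2 μ2 in
/-- calculus: for `G, H` differentiable on a ball around `0` with derivatives `G′, H′` differentiable at `0` (`G″(0) = G2`),
`iteratedDeriv 2 (e ↦ −G(e) − κe²H(e)) 0 = −G2 − 2κH(0)` and `iteratedDeriv 2 G 0 = G2`. [folklore] -/
private theorem iteratedDeriv_two_neg_sub_sq_mul {G H G' H' : ℝ → ℝ} {G2 H2 κ r : ℝ} (hr : 0 < r)
    (hG : ∀ e, |e| < r → HasDerivAt G (G' e) e) (hH : ∀ e, |e| < r → HasDerivAt H (H' e) e)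
    (hG' : HasDerivAt G' G2 0) (hH' : HasDerivAt H' H2 0) :
    iteratedDeriv 2 (fun e => -G e - κ * e ^ 2 * H e) 0 = -G2 - 2 * κ * H 0 ∧ iteratedDeriv 2 G 0 = G2 := by
  have h00 : |(0 : ℝ)| < r := by rwa [abs_zero]
  have hev : deriv (fun e => -G e - κ * e ^ 2 * H e) =ᶠ[𝓝 0] fun e => -G' e - κ * (2 * e * H e + e ^ 2 * H' e) :=
    Filter.eventually_of_mem (ball_mem_nhds' h00) fun e he => by
      have he' := abs_lt_of_mem_ball' he
      have h := (hG e he').neg.sub ((((hasDerivAt_pow 2 e).const_mul κ)).mul (hH e he'))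
      refine (h.congr_deriv ?_).deriv
      simp only [Nat.cast_ofNat]
      ring
  have hevG : deriv G =ᶠ[𝓝 0] G' :=
    Filter.eventually_of_mem (ball_mem_nhds' h00) fun e he => (hG e (abs_lt_of_mem_ball' he)).deriv
  have h1 : HasDerivAt (fun e : ℝ => 2 * e * H e) (2 * H 0) 0 := by
    have h := (((hasDerivAt_id (0 : ℝ)).const_mul 2).mul (hH 0 h00))
    refine h.congr_deriv ?_
    simp only [id, mul_zero, zero_mul, add_zero, mul_one]
  have h2 : HasDerivAt (fun e : ℝ => e ^ 2 * H' e) 0 0 := by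
    have h := (hasDerivAt_pow 2 (0 : ℝ)).mul hH'
    refine h.congr_deriv ?_
    simp
  have h3 : HasDerivAt (fun e => -G' e - κ * (2 * e * H e + e ^ 2 * H' e)) (-G2 - κ * (2 * H 0 + 0)) 0 :=
    hG'.neg.sub ((h1.add h2).const_mul κ)
  refine ⟨?_, ?_⟩
  · rw [iteratedDeriv_succ, iteratedDeriv_one, hev.deriv_eq, h3.deriv]
    ring
  · rw [iteratedDeriv_succ, iteratedDeriv_one, hevG.deriv_eq, hG'.deriv]

/-- **`iteratedDeriv 2` OF THE BODY-OF-RECORD INNER DERIVATIVE AT `e = 0`, RAW FORM**: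
`∂²_e[(∂/∂λ)⁺log Z^{ct}(e,λ)∣_{λ=0}]∣_{e=0} = −(N_U/Z)″(0) − δm²_{(2,1)}·N_Q(0)/Z(0)`, `N_F(e) = ∫dA dφ e^{−S^ε_{e, m²+c(e)}}F`,
`c(e) = δm²_{(2,0)}e² + δm²_{(4,0)}e⁴`, `Z = N_1` (§2's quotient curves with the positive weight `F₀ = 1`; §6's eventual equality;
the calculus lemma above). [cite: Balaban1983Higgs3, (1.20) p.416, (1.24) p.417] -/
theorem iteratedDeriv_two_index21_raw (hw : 0 < w) (hm : 0 < m2) (hμ : 0 < μ2) (d20 d01 d21 d40 : ℝ)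
    {U : Cfg P j N → ℝ} (hU : ∀ φ, U φ = (∑ y : Site P j, w * ‖φ y‖ ^ 4) + 1 / 2 * d01 * massForm w φ) :
    iteratedDeriv 2 (fun e : ℝ => iteratedDerivWithin 1 (fun lam : ℝ => Real.log (∫ p : JCfg P j N,
        J C η w c (m2 + (d20 * e ^ 2 + d01 * lam + d21 * (e ^ 2 * lam) + d40 * e ^ 4)) μ2 e p *
          Real.exp (-(lam * ∑ y : Site P j, w * ‖p.2 y‖ ^ 4)))) (Set.Ici 0) 0) 0 =
      -(iteratedDeriv 2 (fun e : ℝ => (∫ p : JCfg P j N, J C η w c (m2 + (d20 * e ^ 2 + d40 * e ^ 4)) μ2 e p * U p.2) /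
            ∫ p : JCfg P j N, J C η w c (m2 + (d20 * e ^ 2 + d40 * e ^ 4)) μ2 e p * (1 : ℝ)) 0)
        - d21 * ((∫ p : JCfg P j N, J C η w c m2 μ2 0 p * massForm w p.2) /
            ∫ p : JCfg P j N, J C η w c m2 μ2 0 p * (1 : ℝ)) := by
  rw [(iteratedDerivWithin_one_logZct_eventuallyEq C η w c m2 μ2 hw hm hμ d20 d01 d21 d40 hU).iteratedDeriv_eq 2]
  obtain ⟨r, B, hr, hc, hc', hc''⟩ := exists_ball_c20 m2 hm d20 d40
  have hd : ∀ e, |e| < r → HasDerivAt (fun s : ℝ => d20 * s ^ 2 + d40 * s ^ 4) (2 * d20 * e + 4 * d40 * e ^ 3) e :=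
    fun e _ => hasDerivAt_c20 d20 d40 e
  have hd' : ∀ e, |e| < r → HasDerivAt (fun s : ℝ => 2 * d20 * s + 4 * d40 * s ^ 3) (2 * d20 + 12 * d40 * e ^ 2) e :=
    fun e _ => hasDerivAt_c20' d20 d40 e
  have h0 : (fun s : ℝ => d20 * s ^ 2 + d40 * s ^ 4) 0 = 0 := by simp
  have h0' : (fun s : ℝ => 2 * d20 * s + 4 * d40 * s ^ 3) 0 = 0 := by simp
  have hUg := expGrowth_U w d01 hU
  have hmF := B3Eq123RenormalizationConditions.expGrowth_massForm (P := P) (j := j) (N := N) w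
  have h1g : ExpGrowth (fun _ : Cfg P j N => (1 : ℝ)) := ExpGrowth.const 1
  have h1p : ∀ φ : Cfg P j N, (0 : ℝ) < (fun _ : Cfg P j N => (1 : ℝ)) φ := fun _ => one_pos
  -- the two quotient curves `N_U/Z` and `N_Q/Z`
  have hG := fun e (he : |e| < r) =>
    hasDerivAt_quot_curve_of_ball C η w c m2 μ2 hw hm hμ hUg h1g h1p hd hc hc' he
  have hH := fun e (he : |e| < r) =>
    hasDerivAt_quot_curve_of_ball C η w c m2 μ2 hw hm hμ hmF h1g h1p hd hc hc' he
  have hG' := hasDerivAt_deriv_quot_curve_zero_of_ball C η w c m2 μ2 hw hm hμ hUg h1g h1p hr hd hd' hc hc' hc'' h0 h0'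
  have hH' := hasDerivAt_deriv_quot_curve_zero_of_ball C η w c m2 μ2 hw hm hμ hmF h1g h1p hr hd hd' hc hc' hc'' h0 h0'
  have hmain := iteratedDeriv_two_neg_sub_sq_mul (κ := 1 / 2 * d21) hr hG hH hG' hH'
  have hfun : (fun e : ℝ => -((∫ p : JCfg P j N, J C η w c (m2 + (d20 * e ^ 2 + d40 * e ^ 4)) μ2 e p * U p.2) /
            ∫ p : JCfg P j N, J C η w c (m2 + (d20 * e ^ 2 + d40 * e ^ 4)) μ2 e p * (1 : ℝ))
        - 1 / 2 * d21 * e ^ 2 *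
          ((∫ p : JCfg P j N, J C η w c (m2 + (d20 * e ^ 2 + d40 * e ^ 4)) μ2 e p * massForm w p.2) /
            ∫ p : JCfg P j N, J C η w c (m2 + (d20 * e ^ 2 + d40 * e ^ 4)) μ2 e p * (1 : ℝ))) =
      fun e : ℝ => -((∫ p : JCfg P j N, J C η w c (m2 + (fun s : ℝ => d20 * s ^ 2 + d40 * s ^ 4) e) μ2 e p * U p.2) /
            ∫ p : JCfg P j N, J C η w c (m2 + (fun s : ℝ => d20 * s ^ 2 + d40 * s ^ 4) e) μ2 e p *
              (fun _ : Cfg P j N => (1 : ℝ)) p.2)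
        - 1 / 2 * d21 * e ^ 2 *
          ((∫ p : JCfg P j N, J C η w c (m2 + (fun s : ℝ => d20 * s ^ 2 + d40 * s ^ 4) e) μ2 e p * massForm w p.2) /
            ∫ p : JCfg P j N, J C η w c (m2 + (fun s : ℝ => d20 * s ^ 2 + d40 * s ^ 4) e) μ2 e p *
              (fun _ : Cfg P j N => (1 : ℝ)) p.2) := by
    funext e; rfl
  have hfunG : (fun e : ℝ => (∫ p : JCfg P j N, J C η w c (m2 + (d20 * e ^ 2 + d40 * e ^ 4)) μ2 e p * U p.2) /
            ∫ p : JCfg P j N, J C η w c (m2 + (d20 * e ^ 2 + d40 * e ^ 4)) μ2 e p * (1 : ℝ)) =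
      fun e : ℝ => (∫ p : JCfg P j N, J C η w c (m2 + (fun s : ℝ => d20 * s ^ 2 + d40 * s ^ 4) e) μ2 e p * U p.2) /
            ∫ p : JCfg P j N, J C η w c (m2 + (fun s : ℝ => d20 * s ^ 2 + d40 * s ^ 4) e) μ2 e p *
              (fun _ : Cfg P j N => (1 : ℝ)) p.2 := by
    funext e; rfl
  rw [hfun, hmain.1, hfunG, hmain.2]
  have hz : m2 + (fun s : ℝ => d20 * s ^ 2 + d40 * s ^ 4) 0 = m2 := by simp
  rw [hz]
  ring


/-! ## §8 THE VALUE AT `e = 0` AS FREE-FIELD MOMENTS (the `A`-integrals done: BRICK 7 `J_zero`, `integral_D2_J_zero`; §3), AND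
WICK'S THEOREM AT PRINT'S `δm²_{(0,1)} = −4(N+2)C^ε_0(0)`: the interaction is then Wick-ordered, `U = Σ_yη^d:∣φ(y)∣⁴: − const`
(§4 `U_eq_sumWick4_of_print`), and NO connected vacuum graph joins one Wick-ordered quartic vertex to the order-`e²` insertion
`Y = X − δm²_{(2,0)}Q` (② and the mass vertex are bilinear — they absorb two legs, the other two would form a self-line; for ④ each
current `⟪φ(b₋),qφ(b₊)⟫` would need both legs at `y`, `q_{ik} + q_{ki} = 0`: §4 `integral_wick4_Y`, `integral_W_Y`), nor is there a
graph with the quartic vertex alone (`⟨V_:⟩₀ = 0`, BRICK 1 `integral_sumWick4`): of the (2,1) vacuum term only the counterterm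
bubble `−δm²_{(2,1)}·⟨Q⟩₀ = −δm²_{(2,1)}·N·Σ_xη^dC^ε_0(x,x)` survives -/

/-- **THE INDEX `(2,1)` OF (1.24), DERIVED FROM THE MEASURE — cumulant form, any counterterm letters.**  For the partition function
of the action (1.20) with `δm² = δm²_{(2,0)}e² + δm²_{(0,1)}λ + δm²_{(2,1)}e²λ + δm²_{(4,0)}e⁴` inserted,
`Z^{ct}(e,λ) = ∫dA dφ e^{−S^ε_{e,m²+δm²(e,λ)}}e^{−λΣ_yη^d∣φ(y)∣⁴}` (`λ ≥ 0`), the body-of-record derivative of `E1of124R` at `(α,β) =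
(2,1)` is **`∂²_e[(∂/∂λ)⁺log Z^{ct}(e,·)∣_{0⁺}]∣_{e=0} = −Cov₀(Y, U) − δm²_{(2,1)}⟨Q⟩₀`**, `Y = X − δm²_{(2,0)}Q` (the `A`-averaged
order-`e²` insertion ②+④ minus its counterterm), `U = Σ_yη^d∣φ(y)∣⁴ + ½δm²_{(0,1)}Q` (the quartic interaction plus the order-`λ`
counterterm), `Q = Σ_xη^d∣φ(x)∣²`, free-field moments `⟨F⟩₀ = ∫W₀F/∫W₀`, `Cov₀(Y,U) = ⟨YU⟩₀ − ⟨Y⟩₀⟨U⟩₀` written over the common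
denominator `(∫W₀)²`.  Print's coefficient of `e²λ` in `E₁` is `(2!·1!)⁻¹` times this number.
[cite: Balaban1983Higgs3, (1.20)–(1.22) p.416, (1.23)–(1.24) p.417] [cite: GlimmJaffeQP1987, §8.4–8.5] -/
theorem iteratedDeriv_two_index21_eq_moments (hw : 0 < w) (hm : 0 < m2) (hμ : 0 < μ2) (d20 d01 d21 d40 : ℝ)
    {X U : Cfg P j N → ℝ}
    (hX : ∀ φ, X φ = (∑ b : PBond P j, w * (c ^ 2 * η ^ 2) * G w c μ2 b.src b.src * ⟪φ b.src, C.q (C.q (φ b.tgt))⟫_ℝ)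
      + ∑ b : PBond P j, ∑ b' : PBond P j, (w * (c ^ 2 * η)) * (w * (c ^ 2 * η)) *
          (G w c μ2 b.src b'.src * if b.dir = b'.dir then 1 else 0) *
            (⟪φ b.src, C.q (φ b.tgt)⟫_ℝ * ⟪φ b'.src, C.q (φ b'.tgt)⟫_ℝ))
    (hU : ∀ φ, U φ = (∑ y : Site P j, w * ‖φ y‖ ^ 4) + 1 / 2 * d01 * massForm w φ) :
    iteratedDeriv 2 (fun e : ℝ => iteratedDerivWithin 1 (fun lam : ℝ => Real.log (∫ p : JCfg P j N,
        J C η w c (m2 + (d20 * e ^ 2 + d01 * lam + d21 * (e ^ 2 * lam) + d40 * e ^ 4)) μ2 e p *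
          Real.exp (-(lam * ∑ y : Site P j, w * ‖p.2 y‖ ^ 4)))) (Set.Ici 0) 0) 0 =
      -(((∫ φ : Cfg P j N, weight C η w c m2 (0 : VecField P j ℝ) φ * ((X φ - d20 * massForm w φ) * U φ)) *
            (∫ φ : Cfg P j N, weight C η w c m2 (0 : VecField P j ℝ) φ)
          - (∫ φ : Cfg P j N, weight C η w c m2 (0 : VecField P j ℝ) φ * U φ) *
            (∫ φ : Cfg P j N, weight C η w c m2 (0 : VecField P j ℝ) φ * (X φ - d20 * massForm w φ))) /
          (∫ φ : Cfg P j N, weight C η w c m2 (0 : VecField P j ℝ) φ) ^ 2)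
        - d21 * ((∫ φ : Cfg P j N, weight C η w c m2 (0 : VecField P j ℝ) φ * massForm w φ) /
            ∫ φ : Cfg P j N, weight C η w c m2 (0 : VecField P j ℝ) φ) := by
  rw [iteratedDeriv_two_index21_raw C η w c m2 μ2 hw hm hμ d20 d01 d21 d40 hU]
  -- the curve `c(e) = δm²_{(2,0)}e² + δm²_{(4,0)}e⁴`
  set ct : ℝ → ℝ := fun e => d20 * e ^ 2 + d40 * e ^ 4 with hct
  set ct' : ℝ → ℝ := fun e => 2 * d20 * e + 4 * d40 * e ^ 3 with hct'
  set ct'' : ℝ → ℝ := fun e => 2 * d20 + 12 * d40 * e ^ 2 with hct''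
  have hd : ∀ e, HasDerivAt ct (ct' e) e := fun e => by
    have h := ((hasDerivAt_pow 2 e).const_mul d20).add ((hasDerivAt_pow 4 e).const_mul d40)
    refine h.congr_deriv ?_
    simp only [hct', Nat.cast_ofNat]
    ring
  have hd' : ∀ e, HasDerivAt ct' (ct'' e) e := fun e => by
    have h := (((hasDerivAt_id e).const_mul (2 * d20))).add ((hasDerivAt_pow 3 e).const_mul (4 * d40))
    refine h.congr_deriv ?_
    simp only [hct'', Nat.cast_ofNat]
    ring
  have hc'' : ContinuousAt ct'' 0 := (continuous_const.add (continuous_const.mul (continuous_pow 2))).continuousAt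
  have h0 : ct 0 = 0 := by simp only [hct]; ring
  have h0' : ct' 0 = 0 := by simp only [hct']; ring
  have hκ : 1 / 2 * ct'' 0 = d20 := by simp only [hct'']; ring
  have hUg := expGrowth_U w d01 hU
  have hmF := B3Eq123RenormalizationConditions.expGrowth_massForm (P := P) (j := j) (N := N) w
  have hXg := expGrowth_X C η w c μ2 hX
  have h1g : ExpGrowth (fun _ : Cfg P j N => (1 : ℝ)) := ExpGrowth.const 1
  have h1p : ∀ φ : Cfg P j N, (0 : ℝ) < (fun _ : Cfg P j N => (1 : ℝ)) φ := fun _ => one_pos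
  have hmain := iteratedDeriv_two_quot_curve_eq_moments C η w c m2 μ2 hw hm hμ hUg h1g h1p hd hd' hc'' h0 h0' hX
  have hfunG : (fun e : ℝ => (∫ p : JCfg P j N, J C η w c (m2 + (d20 * e ^ 2 + d40 * e ^ 4)) μ2 e p * U p.2) /
            ∫ p : JCfg P j N, J C η w c (m2 + (d20 * e ^ 2 + d40 * e ^ 4)) μ2 e p * (1 : ℝ)) =
      fun e : ℝ => (∫ p : JCfg P j N, J C η w c (m2 + ct e) μ2 e p * U p.2) /
            ∫ p : JCfg P j N, J C η w c (m2 + ct e) μ2 e p * (fun _ : Cfg P j N => (1 : ℝ)) p.2 := by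
    funext e; rfl
  rw [hfunG, hmain, hκ]
  -- the `A`-integrals at `e = 0`
  have hZA : (∫ A : Cfg P j P.d, WA η w c μ2 A) ≠ 0 := (ZA_pos η w c μ2 hw hμ).ne'
  have hM0 : (∫ φ : Cfg P j N, weight C η w c m2 (0 : VecField P j ℝ) φ) ≠ 0 := (B3WT226Traces.Z_pos C η w c m2 hw hm).ne'
  have eQ : (∫ p : JCfg P j N, J C η w c m2 μ2 0 p * massForm w p.2) =
      (∫ A : Cfg P j P.d, WA η w c μ2 A) * ∫ φ : Cfg P j N, weight C η w c m2 (0 : VecField P j ℝ) φ * massForm w φ :=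
    integral_J_zero_mul C η w c m2 μ2 (massForm w)
  have e1 : (∫ p : JCfg P j N, J C η w c m2 μ2 0 p * (1 : ℝ)) =
      (∫ A : Cfg P j P.d, WA η w c μ2 A) * ∫ φ : Cfg P j N, weight C η w c m2 (0 : VecField P j ℝ) φ := by
    have h := integral_J_zero_mul (P := P) (j := j) C η w c m2 μ2 (fun _ => (1 : ℝ))
    simp only [mul_one] at h
    simpa only [mul_one] using h
  rw [eQ, e1]
  simp only [mul_one]
  field_simp

omit C η μ2 in
/-- `Σ_xη^dC₀(x,x) = ∣T∣·η^d·C₀(0)` on the torus. [cite: Balaban1983Higgs3, (1.22) p.416] -/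
theorem sum_G_diag : ∑ x : Site P j, w * G w c m2 x x = Fintype.card (Site P j) * (w * C0 (P := P) (j := j) w c m2) := by
  simp_rw [G_diag w c m2]
  rw [Finset.sum_const, Finset.card_univ, nsmul_eq_mul]

/-- **THE INDEX `(2,1)` OF (1.24) AT PRINT'S `δm²_{(0,1)} = −4(N+2)C^ε_0(0)`, IN CLOSED FORM: only the `δm²_{(2,1)}` bubble.**
With the quartic interaction Wick-ordered by print's order-`λ` counterterm (`U = V_: − ∣T∣η^dN(N+2)C₀(0)²`, `V_: = Σ_yη^d:∣φ(y)∣⁴:`;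
the constant drops out of the covariance), `Cov₀(Y, V_:) = ⟨V_:Y⟩₀ − ⟨V_:⟩₀⟨Y⟩₀ = 0 − 0` (§4 `integral_W_Y`: no connected vacuum
graph «:∣φ(y)∣⁴: × {②, ④, mass vertex}»; BRICK 1 `integral_sumWick4`), so
**`∂²_e[(∂/∂λ)⁺log Z^{ct}(e,·)∣_{0⁺}]∣_{e=0} = −δm²_{(2,1)}·N·Σ_xη^dC^ε_0(x,x)`** (`⟨Q⟩₀ = N·Σ_xη^dC₀(x,x)`, §4
`integral_W0_massForm`) — whatever `δm²_{(2,0)}, δm²_{(2,1)}, δm²_{(4,0)}` are. [cite: Balaban1983Higgs3, (1.20)–(1.22) p.416,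
(1.23)–(1.24) p.417] [cite: GlimmJaffeQP1987, Cor. 8.3.2, (9.1.5)] -/
theorem iteratedDeriv_two_index21_at_print_d01 (hw : 0 < w) (hm : 0 < m2) (hμ : 0 < μ2) (d20 d01 d21 d40 : ℝ)
    (hd01 : d01 = -(4 * (N + 2) * C0 (P := P) (j := j) w c m2)) :
    iteratedDeriv 2 (fun e : ℝ => iteratedDerivWithin 1 (fun lam : ℝ => Real.log (∫ p : JCfg P j N,
        J C η w c (m2 + (d20 * e ^ 2 + d01 * lam + d21 * (e ^ 2 * lam) + d40 * e ^ 4)) μ2 e p *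
          Real.exp (-(lam * ∑ y : Site P j, w * ‖p.2 y‖ ^ 4)))) (Set.Ici 0) 0) 0 =
      -(d21 * (N * ∑ x : Site P j, w * G w c m2 x x)) := by
  -- the observables as functions with defining hypotheses
  set X : Cfg P j N → ℝ := fun φ =>
    (∑ b : PBond P j, w * (c ^ 2 * η ^ 2) * G w c μ2 b.src b.src * ⟪φ b.src, C.q (C.q (φ b.tgt))⟫_ℝ)
      + ∑ b : PBond P j, ∑ b' : PBond P j, (w * (c ^ 2 * η)) * (w * (c ^ 2 * η)) *
          (G w c μ2 b.src b'.src * if b.dir = b'.dir then 1 else 0) *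
            (⟪φ b.src, C.q (φ b.tgt)⟫_ℝ * ⟪φ b'.src, C.q (φ b'.tgt)⟫_ℝ) with hXd
  have hX : ∀ φ, X φ = (∑ b : PBond P j, w * (c ^ 2 * η ^ 2) * G w c μ2 b.src b.src * ⟪φ b.src, C.q (C.q (φ b.tgt))⟫_ℝ)
      + ∑ b : PBond P j, ∑ b' : PBond P j, (w * (c ^ 2 * η)) * (w * (c ^ 2 * η)) *
          (G w c μ2 b.src b'.src * if b.dir = b'.dir then 1 else 0) *
            (⟪φ b.src, C.q (φ b.tgt)⟫_ℝ * ⟪φ b'.src, C.q (φ b'.tgt)⟫_ℝ) := fun φ => rfl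
  set U : Cfg P j N → ℝ := fun φ => (∑ y : Site P j, w * ‖φ y‖ ^ 4) + 1 / 2 * d01 * massForm w φ with hUd
  have hU : ∀ φ, U φ = (∑ y : Site P j, w * ‖φ y‖ ^ 4) + 1 / 2 * d01 * massForm w φ := fun φ => rfl
  set Y : Cfg P j N → ℝ := fun φ => X φ - d20 * massForm w φ with hYd
  have hY : ∀ φ, Y φ = X φ - d20 * massForm w φ := fun φ => rfl
  set W : Cfg P j N → ℝ := fun φ => ∑ y : Site P j, w * wick4 w c m2 y φ with hWd
  have hW : ∀ φ, W φ = ∑ y : Site P j, w * wick4 w c m2 y φ := fun φ => rfl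
  set K0 : ℝ := Fintype.card (Site P j) * (w * (N * (N + 2) * C0 (P := P) (j := j) w c m2 ^ 2)) with hK0
  have hUW : ∀ φ, U φ = W φ - K0 := fun φ => U_eq_sumWick4_of_print w c m2 d01 hd01 hU φ
  have hlhs : (fun e : ℝ => iteratedDerivWithin 1 (fun lam : ℝ => Real.log (∫ p : JCfg P j N,
        J C η w c (m2 + (d20 * e ^ 2 + d01 * lam + d21 * (e ^ 2 * lam) + d40 * e ^ 4)) μ2 e p *
          Real.exp (-(lam * ∑ y : Site P j, w * ‖p.2 y‖ ^ 4)))) (Set.Ici 0) 0) =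
      fun e : ℝ => iteratedDerivWithin 1 (fun lam : ℝ => Real.log (∫ p : JCfg P j N,
        J C η w c (m2 + (d20 * e ^ 2 + d01 * lam + d21 * (e ^ 2 * lam) + d40 * e ^ 4)) μ2 e p *
          Real.exp (-(lam * ∑ y : Site P j, w * ‖p.2 y‖ ^ 4)))) (Set.Ici 0) 0 := rfl
  rw [iteratedDeriv_two_index21_eq_moments C η w c m2 μ2 hw hm hμ d20 d01 d21 d40 hX hU]
  -- integrability
  have hXg := expGrowth_X C η w c μ2 hX
  have hmF := B3Eq123RenormalizationConditions.expGrowth_massForm (P := P) (j := j) (N := N) w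
  have hYg : ExpGrowth Y := hXg.sub (hmF.const_mul d20)
  have hWg : ExpGrowth W := ExpGrowth.sum _ fun y _ => (expGrowth_wick4 w c m2 y).const_mul w
  have iYW := (hWg.mul hYg).integrable C η w c m2 hw hm
  have iY := hYg.integrable C η w c m2 hw hm
  have iW := hWg.integrable C η w c m2 hw hm
  have i1 := (ExpGrowth.const (1 : ℝ) : ExpGrowth (fun _ : Cfg P j N => (1 : ℝ))).integrable C η w c m2 hw hm
  -- `⟨(X − d20Q)·U⟩ = ⟨W·Y⟩ − K₀⟨Y⟩ = −K₀⟨Y⟩`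
  have e1 : (∫ φ : Cfg P j N, weight C η w c m2 (0 : VecField P j ℝ) φ * ((X φ - d20 * massForm w φ) * U φ)) =
      -(K0 * ∫ φ : Cfg P j N, weight C η w c m2 (0 : VecField P j ℝ) φ * Y φ) := by
    have h : (fun φ : Cfg P j N => weight C η w c m2 (0 : VecField P j ℝ) φ * ((X φ - d20 * massForm w φ) * U φ)) =
        fun φ => weight C η w c m2 (0 : VecField P j ℝ) φ * (W φ * Y φ)
          - K0 * (weight C η w c m2 (0 : VecField P j ℝ) φ * Y φ) := by
      funext φ; rw [hUW, hY]; ring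
    rw [h, integral_sub iYW (iY.const_mul K0), integral_const_mul, integral_W_Y C η w c m2 μ2 hw hm d20 hX hY hW]
    ring
  -- `⟨U⟩ = ⟨V_:⟩ − K₀ = −K₀`
  have e2 : (∫ φ : Cfg P j N, weight C η w c m2 (0 : VecField P j ℝ) φ * U φ) =
      -(K0 * ∫ φ : Cfg P j N, weight C η w c m2 (0 : VecField P j ℝ) φ) := by
    have h : (fun φ : Cfg P j N => weight C η w c m2 (0 : VecField P j ℝ) φ * U φ) =
        fun φ => weight C η w c m2 (0 : VecField P j ℝ) φ * W φ - K0 * (weight C η w c m2 (0 : VecField P j ℝ) φ * 1) := by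
      funext φ; rw [hUW]; ring
    have i1' : Integrable (fun φ : Cfg P j N => K0 * (weight C η w c m2 (0 : VecField P j ℝ) φ * 1)) := i1.const_mul K0
    rw [h, integral_sub iW i1', integral_const_mul]
    have hW0 : (∫ φ : Cfg P j N, weight C η w c m2 (0 : VecField P j ℝ) φ * W φ) = 0 :=
      B3Eq122FirstOrderWick.integral_sumWick4 C η w c m2 hw hm
    rw [hW0]
    simp only [mul_one]
    ring
  have e3 : (∫ φ : Cfg P j N, weight C η w c m2 (0 : VecField P j ℝ) φ * (X φ - d20 * massForm w φ)) =
      ∫ φ : Cfg P j N, weight C η w c m2 (0 : VecField P j ℝ) φ * Y φ := rfl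
  rw [e1, e2, e3, integral_W0_massForm C η w c m2 hw hm]
  have hM0 : (∫ φ : Cfg P j N, weight C η w c m2 (0 : VecField P j ℝ) φ) ≠ 0 := (B3WT226Traces.Z_pos C η w c m2 hw hm).ne'
  field_simp
  ring

/-- **THE `(2,1)` TERM OF `E₁`** (the body of record `B3Sect1TwoPoint.E1of124R`: `Σ (α!β!)⁻¹e^αλ^β·iteratedDeriv α (e′ ↦
iteratedDerivWithin β (λ′ ↦ log Z(e′,λ′)) [0,∞) 0) 0` at the generating function `log Z^{ct}` of (1.20)), at print's `δm²_{(0,1)}`: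
**`(2!·1!)⁻¹e²λ·∂²_e(∂/∂λ)⁺log Z^{ct}∣₀ = −½·δm²_{(2,1)}·N·Σ_xη^dC^ε_0(x,x)·e²λ`**. [cite: Balaban1983Higgs3, (1.24) p.417] -/
theorem E1_term_21_at_print_d01 (hw : 0 < w) (hm : 0 < m2) (hμ : 0 < μ2) (d20 d01 d21 d40 e lam : ℝ)
    (hd01 : d01 = -(4 * (N + 2) * C0 (P := P) (j := j) w c m2)) :
    1 / ((Nat.factorial 2 : ℝ) * (Nat.factorial 1 : ℝ)) * e ^ 2 * lam ^ 1 *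
        iteratedDeriv 2 (fun e' : ℝ => iteratedDerivWithin 1 (fun lam' : ℝ => Real.log (∫ p : JCfg P j N,
          J C η w c (m2 + (d20 * e' ^ 2 + d01 * lam' + d21 * (e' ^ 2 * lam') + d40 * e' ^ 4)) μ2 e' p *
            Real.exp (-(lam' * ∑ y : Site P j, w * ‖p.2 y‖ ^ 4)))) (Set.Ici 0) 0) 0 =
      -(1 / 2 * d21 * (N * ∑ x : Site P j, w * G w c m2 x x)) * (e ^ 2 * lam) := by
  rw [iteratedDeriv_two_index21_at_print_d01 C η w c m2 μ2 hw hm hμ d20 d01 d21 d40 hd01]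
  simp only [Nat.factorial, Nat.succ_eq_add_one, Nat.cast_mul, pow_one]
  ring

/-- **THE `(2,1)` VACUUM TERM IS EXTENSIVE**: `∂²_e(∂/∂λ)⁺log Z^{ct}∣₀ = −∣T_ε∣·δm²_{(2,1)}·N·η^dC^ε_0(0)` at print's `δm²_{(0,1)}` —
`∣T_ε∣` times a density independent of the volume's shape (the bubble is local). [cite: Balaban1983Higgs3, (1.24) p.417] -/
theorem iteratedDeriv_two_index21_at_print_d01_eq_card_mul (hw : 0 < w) (hm : 0 < m2) (hμ : 0 < μ2)
    (d20 d01 d21 d40 : ℝ) (hd01 : d01 = -(4 * (N + 2) * C0 (P := P) (j := j) w c m2)) :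
    iteratedDeriv 2 (fun e : ℝ => iteratedDerivWithin 1 (fun lam : ℝ => Real.log (∫ p : JCfg P j N,
        J C η w c (m2 + (d20 * e ^ 2 + d01 * lam + d21 * (e ^ 2 * lam) + d40 * e ^ 4)) μ2 e p *
          Real.exp (-(lam * ∑ y : Site P j, w * ‖p.2 y‖ ^ 4)))) (Set.Ici 0) 0) 0 =
      -(Fintype.card (Site P j) * (d21 * N * (w * C0 (P := P) (j := j) w c m2))) := by
  rw [iteratedDeriv_two_index21_at_print_d01 C η w c m2 μ2 hw hm hμ d20 d01 d21 d40 hd01, sum_G_diag w c m2]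
  ring


/-! ## §9 THE INDEX `(0,1)` ON THE SAME CARRIER (consistency with BRICK 12 §10): the body of record's term at `(α,β) = (0,1)` is
the inner right `λ`-derivative evaluated at `e = 0` (`iteratedDeriv 0`), where the vector-field integral cancels -/

/-- **`iteratedDeriv 0 (e ↦ iteratedDerivWithin 1 (λ ↦ log Z^{ct}(e,λ)) [0,∞) 0) 0 = −⟨U⟩₀ = −∫W₀U/∫W₀`** — at `e = 0` the joint
weight factors (BRICK 7 `J_zero`) and `Z_A` cancels: BRICK 12 §10's scalar-carrier first-order value, on BRICK 7's joint carrier,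
for any counterterm letters. [cite: Balaban1983Higgs3, (1.20) p.416, (1.23)–(1.24) p.417] [cite: GlimmJaffeQP1987, §8.4–8.5] -/
theorem iteratedDeriv_zero_index01 (hw : 0 < w) (hm : 0 < m2) (hμ : 0 < μ2) (d20 d01 d21 d40 : ℝ) {U : Cfg P j N → ℝ}
    (hU : ∀ φ, U φ = (∑ y : Site P j, w * ‖φ y‖ ^ 4) + 1 / 2 * d01 * massForm w φ) :
    iteratedDeriv 0 (fun e : ℝ => iteratedDerivWithin 1 (fun lam : ℝ => Real.log (∫ p : JCfg P j N,
        J C η w c (m2 + (d20 * e ^ 2 + d01 * lam + d21 * (e ^ 2 * lam) + d40 * e ^ 4)) μ2 e p *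
          Real.exp (-(lam * ∑ y : Site P j, w * ‖p.2 y‖ ^ 4)))) (Set.Ici 0) 0) 0 =
      -(∫ φ : Cfg P j N, weight C η w c m2 (0 : VecField P j ℝ) φ * U φ) /
        ∫ φ : Cfg P j N, weight C η w c m2 (0 : VecField P j ℝ) φ := by
  rw [iteratedDeriv_zero]
  have he : |d20 * (0 : ℝ) ^ 2 + d40 * (0 : ℝ) ^ 4| ≤ m2 / 2 := by norm_num; exact (half_pos hm).le
  rw [iteratedDerivWithin_one_logZct C η w c m2 μ2 hw hm hμ d20 d01 d21 d40 hU he]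
  have hz : m2 + (d20 * (0 : ℝ) ^ 2 + d40 * (0 : ℝ) ^ 4) = m2 := by ring
  have e1 : (∫ p : JCfg P j N, J C η w c (m2 + (d20 * (0 : ℝ) ^ 2 + d40 * (0 : ℝ) ^ 4)) μ2 0 p *
      (U p.2 + 1 / 2 * (d21 * (0 : ℝ) ^ 2) * massForm w p.2)) = ∫ p : JCfg P j N, J C η w c m2 μ2 0 p * U p.2 :=
    integral_congr_ae (Filter.Eventually.of_forall fun p => by dsimp only; rw [hz]; ring)
  have e2 : (∫ p : JCfg P j N, J C η w c (m2 + (d20 * (0 : ℝ) ^ 2 + d40 * (0 : ℝ) ^ 4)) μ2 0 p) =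
      ∫ p : JCfg P j N, J C η w c m2 μ2 0 p * (fun _ : Cfg P j N => (1 : ℝ)) p.2 :=
    integral_congr_ae (Filter.Eventually.of_forall fun p => by dsimp only; rw [hz, mul_one])
  rw [e1, e2, integral_J_zero_mul C η w c m2 μ2 U, integral_J_zero_mul (P := P) (j := j) C η w c m2 μ2 (fun _ => (1 : ℝ))]
  simp only [mul_one]
  have hZA : (∫ A : Cfg P j P.d, WA η w c μ2 A) ≠ 0 := (ZA_pos η w c μ2 hw hμ).ne'
  have hM0 : (∫ φ : Cfg P j N, weight C η w c m2 (0 : VecField P j ℝ) φ) ≠ 0 := (B3WT226Traces.Z_pos C η w c m2 hw hm).ne'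
  field_simp

/-- **THE INDEX `(0,1)` AT PRINT'S `δm²_{(0,1)}`, ON THE SAME CARRIER: `= ∣T∣·η^d·N(N+2)·C^ε_0(0)²`** — the Wick-ordered interaction
has mean zero (BRICK 1 `integral_sumWick4`), the constant of the Wick ordering `:∣φ∣⁴: = ∣φ∣⁴ − 2(N+2)C₀(0)∣φ∣² + N(N+2)C₀(0)²`
remains (BRICK 12 §10's `(0,1)` vacuum value). [cite: Balaban1983Higgs3, (1.23)–(1.24) p.417] [cite: GlimmJaffeQP1987, (9.1.5)] -/
theorem iteratedDeriv_zero_index01_at_print_d01 (hw : 0 < w) (hm : 0 < m2) (hμ : 0 < μ2) (d20 d01 d21 d40 : ℝ)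
    (hd01 : d01 = -(4 * (N + 2) * C0 (P := P) (j := j) w c m2)) :
    iteratedDeriv 0 (fun e : ℝ => iteratedDerivWithin 1 (fun lam : ℝ => Real.log (∫ p : JCfg P j N,
        J C η w c (m2 + (d20 * e ^ 2 + d01 * lam + d21 * (e ^ 2 * lam) + d40 * e ^ 4)) μ2 e p *
          Real.exp (-(lam * ∑ y : Site P j, w * ‖p.2 y‖ ^ 4)))) (Set.Ici 0) 0) 0 =
      Fintype.card (Site P j) * (w * (N * (N + 2) * C0 (P := P) (j := j) w c m2 ^ 2)) := by
  set U : Cfg P j N → ℝ := fun φ => (∑ y : Site P j, w * ‖φ y‖ ^ 4) + 1 / 2 * d01 * massForm w φ with hUd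
  have hU : ∀ φ, U φ = (∑ y : Site P j, w * ‖φ y‖ ^ 4) + 1 / 2 * d01 * massForm w φ := fun φ => rfl
  rw [iteratedDeriv_zero_index01 C η w c m2 μ2 hw hm hμ d20 d01 d21 d40 hU]
  set K0 : ℝ := Fintype.card (Site P j) * (w * (N * (N + 2) * C0 (P := P) (j := j) w c m2 ^ 2)) with hK0
  have hUW : ∀ φ, U φ = (∑ y : Site P j, w * wick4 w c m2 y φ) - K0 := fun φ => U_eq_sumWick4_of_print w c m2 d01 hd01 hU φ
  have hWg : ExpGrowth (fun φ : Cfg P j N => ∑ y : Site P j, w * wick4 w c m2 y φ) :=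
    ExpGrowth.sum _ fun y _ => (expGrowth_wick4 w c m2 y).const_mul w
  have iW := hWg.integrable C η w c m2 hw hm
  have i1 := (ExpGrowth.const (1 : ℝ) : ExpGrowth (fun _ : Cfg P j N => (1 : ℝ))).integrable C η w c m2 hw hm
  have h : (fun φ : Cfg P j N => weight C η w c m2 (0 : VecField P j ℝ) φ * U φ) =
      fun φ => weight C η w c m2 (0 : VecField P j ℝ) φ * (∑ y : Site P j, w * wick4 w c m2 y φ)
        - K0 * (weight C η w c m2 (0 : VecField P j ℝ) φ * 1) := by
    funext φ; rw [hUW]; ring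
  rw [h, integral_sub iW (i1.const_mul K0), integral_const_mul, B3Eq122FirstOrderWick.integral_sumWick4 C η w c m2 hw hm]
  simp only [mul_one]
  have hM0 : (∫ φ : Cfg P j N, weight C η w c m2 (0 : VecField P j ℝ) φ) ≠ 0 := (B3WT226Traces.Z_pos C η w c m2 hw hm).ne'
  field_simp
  ring


end Literature.MathematicalPhysics.QuantumFieldTheory.Balaban1983to89.B3Eq124IndexTwoOne
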